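import Literature.Barriers.CriticalPhenomena.SAPBuildingBlocksPatterns
import Literature.Barriers.CriticalPhenomena.SAPAnisotropicNotDFinite242PartialFractions
import HarnessLib

/-!
# Lemma 21, the generating function: `Rechnitzer2006_eq29` discharged

Last companion of `Literature/Barriers/CriticalPhenomena/SAPAnisotropicNotDFinite242Hadamard.lean`
(A. Rechnitzer, *Haruspicy 2*, J. Combin. Theory Ser. A 113 (2006) 520–546, arXiv:math/0406450v2,
§3.3), whose named fact `Rechnitzer2006_eq29` (eq. (29) with (31): the partial fraction form of the
building-block generating function `𝒯 = T(t/x,s;x,y)/y⁴ = bbSeries`) was reduced by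
`SAPAnisotropicNotDFinite242PartialFractions` to **Lemma 21 in cleared form**,
`(1-x)³(1-sx)⁶(1-t)⁶(1-st)(1-sxt) · bbSeries = lem21Num` (`Rechnitzer2006_eq29_of_lem21Num`).
This file PROVES that identity (`lem21_cleared`) and hence **`Rechnitzer2006_eq29_holds`**.

The proof is the enumeration of `SAPBuildingBlocksPatterns` (`card_bbWords_eq_sum`: the words of
`bbWords M t w` correspond to the pairs (valid labelled pattern `P`, positive gap vector `n`) with
`t = Σ nᵢaᵢ`, `w = Σ nᵢbᵢ`, `M - t = Σ nᵢeᵢ`) turned into generating functions: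

* `c3 F t j w = [tᵗ xʲ sʷ] F` on `ℚ[s]⟦x⟧⟦t⟧` and its calculus (`ext3`, `c3_mul`, `c3_mono_mul`);
* the one-gap series `gp (a,b,e) = Σ_{n ≥ 1} (tᵃ sᵇ xᵉ)ⁿ` (`c3_gp`, `one_sub_mono_mul_gp`:
  `(1 - tᵃsᵇxᵉ) · gp = tᵃsᵇxᵉ`) and the pattern series `S ws = Π gp wᵢ`, whose coefficients count
  the positive solutions of `Σ nᵢ wᵢ = (t, w, j)` (`c3_S`, `cnt`, `card_sol_eq_cnt`);
* `bbSeries = Σ_{P ∈ validPats} S (weights P)` (`bbSeries_eq_sum`), and clearing denominators: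
  every gap weight is one of `t, st, stx, x, sx` (kernel check on the pattern data), so
  `D₂ · S (weights P)` is the polynomial `term (bbKey P)` (`bbD_mul_S`), where
  `D₂ = (1-t)⁶(1-st)(1-stx)²(1-x)³(1-sx)⁶` and `bbKey P` counts the five weight types;
* the CERTIFICATE `bb_certificate`: `Σ_{keys} (multiplicity) · term bbKey = (1 - stx) · lem21Num`, a
  polynomial identity in three variables (the `122` multiplicities `keyTable` are checked against
  the pattern data by the kernel, `keyTable_count`), proved by `ring`;
* cancellation of `1 - stx` (`cancel_one_sub_C_mul_X`) and `Rechnitzer2006_eq29_of_lem21Num`.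

## References

* A. Rechnitzer, *Haruspicy 2*, op. cit., §3.3, Lemma 21, eqs. (29), (31). [Rechnitzer2006Haruspicy2]
-/

noncomputable section

open Finset PowerSeries Literature.Probability.LatticeModels
open scoped BigOperators Polynomial

namespace Literature.Barriers.CriticalPhenomena

namespace Haruspicy

/-! ### Trivariate coefficients on `ℚ[s]⟦x⟧⟦t⟧` -/

section Coeff3

/-- The ring `ℚ[s]⟦x⟧⟦t⟧`. [folklore] -/
abbrev R3 : Type := PowerSeries (PowerSeries ℚ[X])

/-- `[tᵗ xʲ sʷ] F`. [folklore] -/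
def c3 (F : R3) (t j w : ℕ) : ℚ := ((PowerSeries.coeff j (PowerSeries.coeff t F) : ℚ[X])).coeff w

/-- Extensionality in the three coefficients. [folklore] -/
theorem ext3 {F G : R3} (h : ∀ t j w, c3 F t j w = c3 G t j w) : F = G := by
  ext t j w
  exact h t j w

/-- `c3` is additive. [folklore] -/
theorem c3_add (F G : R3) (t j w : ℕ) : c3 (F + G) t j w = c3 F t j w + c3 G t j w := by
  simp [c3]

/-- `c3` of a finite sum. [folklore] -/
theorem c3_sum {ι : Type*} (s : Finset ι) (F : ι → R3) (t j w : ℕ) :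
    c3 (∑ i ∈ s, F i) t j w = ∑ i ∈ s, c3 (F i) t j w := by
  simp [c3, map_sum, Polynomial.finsetSum_coeff]

/-- `c3` of a subtraction. [folklore] -/
theorem c3_sub (F G : R3) (t j w : ℕ) : c3 (F - G) t j w = c3 F t j w - c3 G t j w := by
  simp [c3]

/-- The monomial `tᵃ sᵇ xᵉ`. [folklore] -/
def mono (a b e : ℕ) : R3 :=
  PowerSeries.X ^ a * PowerSeries.C (PowerSeries.X ^ e * PowerSeries.C ((Polynomial.X : ℚ[X]) ^ b))

/-- **Multiplication by a monomial shifts the coefficients.** [folklore] -/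
theorem c3_mono_mul (a b e : ℕ) (F : R3) (t j w : ℕ) :
    c3 (mono a b e * F) t j w = if a ≤ t ∧ e ≤ j ∧ b ≤ w then c3 F (t - a) (j - e) (w - b) else 0 := by
  rw [c3, mono, mul_assoc, PowerSeries.coeff_X_pow_mul']
  split_ifs with h1 h2 h2
  · rw [PowerSeries.coeff_C_mul, mul_assoc, PowerSeries.coeff_X_pow_mul', if_pos h2.2.1, PowerSeries.coeff_C_mul,
      Polynomial.coeff_X_pow_mul', if_pos h2.2.2, c3]
  · rw [PowerSeries.coeff_C_mul, mul_assoc, PowerSeries.coeff_X_pow_mul']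
    by_cases he : e ≤ j
    · rw [if_pos he, PowerSeries.coeff_C_mul, Polynomial.coeff_X_pow_mul', if_neg (fun hb => h2 ⟨h1, he, hb⟩)]
    · rw [if_neg he, Polynomial.coeff_zero]
  · exact absurd h2.1 h1
  · simp

/-- `c3 1`. [folklore] -/
theorem c3_one (t j w : ℕ) : c3 (1 : R3) t j w = if t = 0 ∧ j = 0 ∧ w = 0 then 1 else 0 := by
  rw [c3, PowerSeries.coeff_one]
  by_cases ht : t = 0
  · subst ht
    rw [if_pos rfl, PowerSeries.coeff_one]
    by_cases hj : j = 0
    · subst hj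
      rw [if_pos rfl, Polynomial.coeff_one]
      rcases eq_or_ne w 0 with rfl | hw
      · simp
      · simp [hw]
    · rw [if_neg hj, Polynomial.coeff_zero, if_neg (fun h => hj h.2.1)]
  · rw [if_neg ht, map_zero, Polynomial.coeff_zero, if_neg (fun h => ht h.1)]

/-- `c3` of a monomial. [folklore] -/
theorem c3_mono (a b e t j w : ℕ) : c3 (mono a b e) t j w = if t = a ∧ j = e ∧ w = b then 1 else 0 := by
  rw [← mul_one (mono a b e), c3_mono_mul, c3_one]
  by_cases h : t = a ∧ j = e ∧ w = b
  · obtain ⟨rfl, rfl, rfl⟩ := h; simp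
  · rw [if_neg h]
    by_cases h' : a ≤ t ∧ e ≤ j ∧ b ≤ w
    · rw [if_pos h', if_neg]; rintro ⟨h1, h2, h3⟩; exact h ⟨by omega, by omega, by omega⟩
    · rw [if_neg h']

/-- **The Cauchy product in three indices.** [folklore] -/
theorem c3_mul (F G : R3) (t j w : ℕ) :
    c3 (F * G) t j w = ∑ p ∈ antidiagonal t, ∑ q ∈ antidiagonal j, ∑ r ∈ antidiagonal w,
      c3 F p.1 q.1 r.1 * c3 G p.2 q.2 r.2 := by
  rw [c3, PowerSeries.coeff_mul, map_sum, Polynomial.finsetSum_coeff]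
  refine Finset.sum_congr rfl fun p _ => ?_
  rw [PowerSeries.coeff_mul, Polynomial.finsetSum_coeff]
  refine Finset.sum_congr rfl fun q _ => ?_
  rw [Polynomial.coeff_mul]
  rfl

end Coeff3

/-! ### The one-gap geometric series and the pattern series -/

section Gp

/-- A gap weight `(a, b, e)`: a unit of the gap contributes `tᵃ sᵇ xᵉ`. [folklore] -/
abbrev Wt : Type := ℕ × ℕ × ℕ

/-- `gp (a,b,e) = Σ_{n ≥ 1} (tᵃ sᵇ xᵉ)ⁿ`, as an explicit series (for `a + e ≥ 1`, when at most
`t + j` units fit under `tᵗ xʲ`). [folklore] -/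
def gp (μ : Wt) : R3 :=
  PowerSeries.mk fun t => PowerSeries.mk fun j =>
    ∑ n ∈ Icc 1 (t + j), if n * μ.1 = t ∧ n * μ.2.2 = j then (Polynomial.X : ℚ[X]) ^ (n * μ.2.1) else 0

/-- The multiplicity `n` fitting under `tᵗ xʲ` is unique when `a + e ≥ 1`. [folklore] -/
theorem mult_unique {μ : Wt} (hμ : 1 ≤ μ.1 + μ.2.2) {n n' t j : ℕ} (h : n * μ.1 = t ∧ n * μ.2.2 = j)
    (h' : n' * μ.1 = t ∧ n' * μ.2.2 = j) : n = n' := by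
  rcases Nat.eq_zero_or_pos μ.1 with h0 | hpos
  · have he : 1 ≤ μ.2.2 := by omega
    exact Nat.eq_of_mul_eq_mul_right he (h.2.trans h'.2.symm)
  · exact Nat.eq_of_mul_eq_mul_right hpos (h.1.trans h'.1.symm)

open Classical in
/-- **The coefficients of `gp`**: `1` exactly at the positive multiples of the weight. [folklore] -/
theorem c3_gp {μ : Wt} (hμ : 1 ≤ μ.1 + μ.2.2) (t j w : ℕ) :
    c3 (gp μ) t j w = if ∃ n, 1 ≤ n ∧ n * μ.1 = t ∧ n * μ.2.2 = j ∧ n * μ.2.1 = w then 1 else 0 := by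
  rw [c3, gp, PowerSeries.coeff_mk, PowerSeries.coeff_mk, Polynomial.finsetSum_coeff]
  simp only [apply_ite (fun p : ℚ[X] => p.coeff w), Polynomial.coeff_X_pow, Polynomial.coeff_zero]
  split_ifs with hex
  · obtain ⟨n, hn1, hnt, hnj, hnw⟩ := hex
    have hnle : n ≤ t + j := by nlinarith
    rw [Finset.sum_eq_single n]
    · rw [if_pos ⟨hnt, hnj⟩, if_pos hnw.symm]
    · intro m hm hmn
      rw [Finset.mem_Icc] at hm
      by_cases hm' : m * μ.1 = t ∧ m * μ.2.2 = j
      · exact absurd (mult_unique hμ hm' ⟨hnt, hnj⟩) hmn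
      · rw [if_neg hm']
    · intro hn; exact absurd (Finset.mem_Icc.mpr ⟨hn1, hnle⟩) hn
  · refine Finset.sum_eq_zero fun m hm => ?_
    rw [Finset.mem_Icc] at hm
    by_cases hm' : m * μ.1 = t ∧ m * μ.2.2 = j
    · rw [if_pos hm', if_neg]
      intro hw
      exact hex ⟨m, hm.1, hm'.1, hm'.2, hw.symm⟩
    · rw [if_neg hm']

open Classical in
/-- **`(1 - tᵃsᵇxᵉ) · gp = tᵃsᵇxᵉ`**: `gp` is the geometric series without constant term.
[folklore] -/
theorem one_sub_mono_mul_gp {μ : Wt} (hμ : 1 ≤ μ.1 + μ.2.2) : (1 - mono μ.1 μ.2.1 μ.2.2) * gp μ = mono μ.1 μ.2.1 μ.2.2 := by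
  apply ext3
  intro t j w
  rw [sub_mul, one_mul, c3_sub, c3_mono_mul, c3_gp hμ, c3_mono]
  by_cases hle : μ.1 ≤ t ∧ μ.2.2 ≤ j ∧ μ.2.1 ≤ w
  · rw [if_pos hle, c3_gp hμ]
    by_cases h1 : t = μ.1 ∧ j = μ.2.2 ∧ w = μ.2.1
    · -- `n = 1` fits, no `n ≥ 2` fits under the remainder
      obtain ⟨rfl, rfl, rfl⟩ := h1
      rw [if_pos (show ∃ n, 1 ≤ n ∧ n * μ.1 = μ.1 ∧ n * μ.2.2 = μ.2.2 ∧ n * μ.2.1 = μ.2.1 from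
        ⟨1, le_rfl, by ring, by ring, by ring⟩), if_neg, if_pos ⟨rfl, rfl, rfl⟩]
      · ring
      · rintro ⟨n, hn1, hnt, hnj, -⟩
        rcases Nat.eq_zero_or_pos μ.1 with h0 | hpos
        · have he : 1 ≤ μ.2.2 := by omega
          have : n * μ.2.2 = 0 := by omega
          rw [Nat.mul_eq_zero] at this; omega
        · have : n * μ.1 = 0 := by omega
          rw [Nat.mul_eq_zero] at this; omega
    · rw [if_neg h1]
      -- `n` fits under `(t,j,w)` iff `n - 1 ≥ 1` fits under the remainder
      by_cases hex : ∃ n, 1 ≤ n ∧ n * μ.1 = t ∧ n * μ.2.2 = j ∧ n * μ.2.1 = w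
      · obtain ⟨n, hn1, hnt, hnj, hnw⟩ := hex
        have hn2 : 2 ≤ n := by
          by_contra hlt
          have : n = 1 := by omega
          subst this; simp only [one_mul] at hnt hnj hnw; exact h1 ⟨hnt.symm, hnj.symm, hnw.symm⟩
        have hfit : ∃ n', 1 ≤ n' ∧ n' * μ.1 = t - μ.1 ∧ n' * μ.2.2 = j - μ.2.2 ∧ n' * μ.2.1 = w - μ.2.1 := by
          refine ⟨n - 1, by omega, ?_, ?_, ?_⟩
          · rw [Nat.sub_mul, one_mul]; omega
          · rw [Nat.sub_mul, one_mul]; omega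
          · rw [Nat.sub_mul, one_mul]; omega
        rw [if_pos (show ∃ n, 1 ≤ n ∧ n * μ.1 = t ∧ n * μ.2.2 = j ∧ n * μ.2.1 = w from ⟨n, hn1, hnt, hnj, hnw⟩),
          if_pos hfit]
        ring
      · rw [if_neg hex, if_neg]
        · ring
        · rintro ⟨n, hn1, hnt, hnj, hnw⟩
          refine hex ⟨n + 1, by omega, ?_, ?_, ?_⟩
          · rw [Nat.add_mul, one_mul]; omega
          · rw [Nat.add_mul, one_mul]; omega
          · rw [Nat.add_mul, one_mul]; omega
  · rw [if_neg hle, sub_zero, if_neg]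
    · rw [if_neg]; rintro ⟨rfl, rfl, rfl⟩; exact hle ⟨le_rfl, le_rfl, le_rfl⟩
    · rintro ⟨n, hn1, hnt, hnj, hnw⟩
      apply hle
      refine ⟨?_, ?_, ?_⟩ <;> nlinarith

/-- The number of positive solutions `(n₁, …, n_m)` of `Σ nᵢ wᵢ = (t, j, w)` (componentwise:
`Σ nᵢaᵢ = t`, `Σ nᵢeᵢ = j`, `Σ nᵢbᵢ = w`), computed by peeling off the first weight. [folklore] -/
def cnt : List Wt → ℕ → ℕ → ℕ → ℕ
  | [], t, j, w => if t = 0 ∧ j = 0 ∧ w = 0 then 1 else 0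
  | μ :: ws, t, j, w => ∑ n ∈ Icc 1 (t + j),
      if n * μ.1 ≤ t ∧ n * μ.2.2 ≤ j ∧ n * μ.2.1 ≤ w then cnt ws (t - n * μ.1) (j - n * μ.2.2) (w - n * μ.2.1) else 0

/-- The series of a list of gap weights: the product of the one-gap series. [folklore] -/
def S (ws : List Wt) : R3 := (ws.map gp).prod

/-- A Kronecker delta on an antidiagonal. [folklore] -/
theorem sum_antidiagonal_ite_eq {α : Type*} [AddCommMonoid α] (t A : ℕ) (f : ℕ × ℕ → α) :
    ∑ p ∈ antidiagonal t, (if p.1 = A then f p else 0) = if A ≤ t then f (A, t - A) else 0 := by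
  split_ifs with h
  · rw [Finset.sum_eq_single (A, t - A)]
    · simp
    · rintro ⟨p1, p2⟩ hp hne
      rw [Finset.mem_antidiagonal] at hp
      rw [if_neg]; rintro rfl; apply hne; simp only at hp; exact Prod.ext rfl (by simp only; omega)
    · intro hA; exfalso; exact hA (Finset.mem_antidiagonal.mpr (by simp; omega))
  · refine Finset.sum_eq_zero fun p hp => ?_
    rw [Finset.mem_antidiagonal] at hp
    rw [if_neg]; omega

open Classical in
/-- **The coefficients of `gp μ · F`**: `Σ_{n ≥ 1, nμ ≤ (t,j,w)} c3 F ((t,j,w) - nμ)`. [folklore] -/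
theorem c3_gp_mul {μ : Wt} (hμ : 1 ≤ μ.1 + μ.2.2) (F : R3) (t j w : ℕ) :
    c3 (gp μ * F) t j w = ∑ n ∈ Icc 1 (t + j),
      if n * μ.1 ≤ t ∧ n * μ.2.2 ≤ j ∧ n * μ.2.1 ≤ w then c3 F (t - n * μ.1) (j - n * μ.2.2) (w - n * μ.2.1) else 0 := by
  rw [c3_mul]
  -- the indicator of `gp` as a sum over the multiplicity `n`
  have hind : ∀ p q r : ℕ, p ≤ t → q ≤ j → c3 (gp μ) p q r =
      ∑ n ∈ Icc 1 (t + j), if p = n * μ.1 ∧ q = n * μ.2.2 ∧ r = n * μ.2.1 then 1 else 0 := by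
    intro p q r hp hq
    rw [c3_gp hμ]
    split_ifs with hex
    · obtain ⟨n, hn1, hnp, hnq, hnr⟩ := hex
      rw [Finset.sum_eq_single n, if_pos ⟨hnp.symm, hnq.symm, hnr.symm⟩]
      · intro m hm hmn
        rw [if_neg]
        rintro ⟨h1, h2, -⟩
        exact hmn (mult_unique hμ ⟨h1.symm, h2.symm⟩ ⟨hnp, hnq⟩)
      · intro hn; exfalso; apply hn; rw [Finset.mem_Icc]; exact ⟨hn1, by nlinarith⟩
    · symm; refine Finset.sum_eq_zero fun m hm => ?_
      rw [if_neg]; rintro ⟨h1, h2, h3⟩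
      exact hex ⟨m, (Finset.mem_Icc.mp hm).1, h1.symm, h2.symm, h3.symm⟩
  have step1 : ∀ p ∈ antidiagonal t, ∀ q ∈ antidiagonal j, ∀ r ∈ antidiagonal w,
      c3 (gp μ) p.1 q.1 r.1 * c3 F p.2 q.2 r.2 =
        ∑ n ∈ Icc 1 (t + j), if p.1 = n * μ.1 ∧ q.1 = n * μ.2.2 ∧ r.1 = n * μ.2.1 then c3 F p.2 q.2 r.2 else 0 := by
    intro p hp q hq r hr
    rw [Finset.mem_antidiagonal] at hp hq
    rw [hind p.1 q.1 r.1 (by omega) (by omega), Finset.sum_mul]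
    exact Finset.sum_congr rfl fun n _ => by split_ifs <;> simp
  rw [Finset.sum_congr rfl fun p hp => Finset.sum_congr rfl fun q hq => Finset.sum_congr rfl fun r hr => step1 p hp q hq r hr]
  -- swap the sum over `n` outside and collapse the three Kronecker deltas
  rw [Finset.sum_congr rfl fun p _ => Finset.sum_congr rfl fun q _ => Finset.sum_comm]
  rw [Finset.sum_congr rfl fun p _ => Finset.sum_comm, Finset.sum_comm]
  refine Finset.sum_congr rfl fun n _ => ?_
  have e3 : ∀ p q : ℕ × ℕ, ∑ r ∈ antidiagonal w, (if p.1 = n * μ.1 ∧ q.1 = n * μ.2.2 ∧ r.1 = n * μ.2.1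
      then c3 F p.2 q.2 r.2 else 0) =
      if p.1 = n * μ.1 ∧ q.1 = n * μ.2.2 then (if n * μ.2.1 ≤ w then c3 F p.2 q.2 (w - n * μ.2.1) else 0) else 0 := by
    intro p q
    by_cases hpq : p.1 = n * μ.1 ∧ q.1 = n * μ.2.2
    · rw [if_pos hpq, ← sum_antidiagonal_ite_eq w (n * μ.2.1) (fun r => c3 F p.2 q.2 r.2)]
      exact Finset.sum_congr rfl fun r _ => by
        by_cases hr : r.1 = n * μ.2.1
        · rw [if_pos ⟨hpq.1, hpq.2, hr⟩, if_pos hr]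
        · rw [if_neg (fun h => hr h.2.2), if_neg hr]
    · rw [if_neg hpq]
      exact Finset.sum_eq_zero fun r _ => by rw [if_neg (fun h => hpq ⟨h.1, h.2.1⟩)]
  simp_rw [e3]
  have e2 : ∀ p : ℕ × ℕ, ∑ q ∈ antidiagonal j, (if p.1 = n * μ.1 ∧ q.1 = n * μ.2.2 then
      (if n * μ.2.1 ≤ w then c3 F p.2 q.2 (w - n * μ.2.1) else 0) else 0) =
      if p.1 = n * μ.1 then (if n * μ.2.2 ≤ j then (if n * μ.2.1 ≤ w then c3 F p.2 (j - n * μ.2.2) (w - n * μ.2.1) else 0)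
        else 0) else 0 := by
    intro p
    by_cases hp : p.1 = n * μ.1
    · rw [if_pos hp, ← sum_antidiagonal_ite_eq j (n * μ.2.2) (fun q => if n * μ.2.1 ≤ w then c3 F p.2 q.2 (w - n * μ.2.1) else 0)]
      exact Finset.sum_congr rfl fun q _ => by
        by_cases hq : q.1 = n * μ.2.2
        · rw [if_pos ⟨hp, hq⟩, if_pos hq]
        · rw [if_neg (fun h => hq h.2), if_neg hq]
    · rw [if_neg hp]
      exact Finset.sum_eq_zero fun q _ => by rw [if_neg (fun h => hp h.1)]
  simp_rw [e2]
  rw [sum_antidiagonal_ite_eq t (n * μ.1)]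
  by_cases h : n * μ.1 ≤ t ∧ n * μ.2.2 ≤ j ∧ n * μ.2.1 ≤ w
  · rw [if_pos h, if_pos h.1, if_pos h.2.1, if_pos h.2.2]
  · rw [if_neg h]
    split_ifs <;> first | rfl | (exfalso; exact h ⟨‹_›, ‹_›, ‹_›⟩)

/-- **The coefficients of the pattern series count positive solutions.** [folklore] -/
theorem c3_S {ws : List Wt} (hws : ∀ μ ∈ ws, 1 ≤ μ.1 + μ.2.2) (t j w : ℕ) : c3 (S ws) t j w = cnt ws t j w := by
  induction ws generalizing t j w with
  | nil => rw [S, List.map_nil, List.prod_nil, c3_one, cnt]; norm_cast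
  | cons μ ws ih =>
    rw [S, List.map_cons, List.prod_cons, ← S, c3_gp_mul (hws μ (by simp)), cnt]
    push_cast
    refine Finset.sum_congr rfl fun n _ => ?_
    split_ifs
    · rw [ih (fun ν hν => hws ν (by simp [hν]))]
    · rfl

end Gp

/-! ### Positive solutions as gap vectors; the series of the building blocks -/

section Solutions

/-- The positive solutions `v : Fin m → [1, B]` of `Σ vᵢ fᵢ = (t, j, w)`. [folklore] -/
def sol (m : ℕ) (f : Fin m → Wt) (B t j w : ℕ) : Finset (Fin m → ℕ) :=
  (Fintype.piFinset fun _ : Fin m => Icc 1 B).filter fun v =>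
    ∑ i, v i * (f i).1 = t ∧ ∑ i, v i * (f i).2.2 = j ∧ ∑ i, v i * (f i).2.1 = w

/-- **The positive solutions are counted by `cnt`** (for weights with `a + e ≥ 1` and a bound
`B ≥ t + j`, which no solution attains). [folklore] -/
theorem card_sol (m : ℕ) (f : Fin m → Wt) (hf : ∀ i, 1 ≤ (f i).1 + (f i).2.2) (B t j w : ℕ) (hB : t + j ≤ B) :
    (sol m f B t j w).card = cnt (List.ofFn f) t j w := by
  induction m generalizing t j w with
  | zero =>
    rw [List.ofFn_zero, cnt, sol]
    simp only [Finset.univ_eq_empty, Finset.sum_empty]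
    by_cases h : t = 0 ∧ j = 0 ∧ w = 0
    · obtain ⟨rfl, rfl, rfl⟩ := h
      rw [if_pos ⟨rfl, rfl, rfl⟩, Finset.filter_true_of_mem (fun _ _ => ⟨rfl, rfl, rfl⟩), Fintype.card_piFinset]
      simp
    · rw [if_neg h, Finset.card_eq_zero, Finset.filter_eq_empty_iff]
      rintro v - ⟨h1, h2, h3⟩; exact h ⟨h1.symm, h2.symm, h3.symm⟩
  | succ m ih =>
    rw [List.ofFn_succ, cnt]
    have hf' : ∀ i : Fin m, 1 ≤ (f i.succ).1 + (f i.succ).2.2 := fun i => hf i.succ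
    -- split by the value `n = v 0`
    rw [Finset.card_eq_sum_card_fiberwise (f := fun v : Fin (m + 1) → ℕ => v 0) (t := Icc 1 B)]
    swap
    · intro v hv
      rw [Finset.mem_coe, sol, Finset.mem_filter, Fintype.mem_piFinset] at hv
      exact Finset.mem_coe.mpr (hv.1 0)
    -- the terms `n > t + j` vanish on both sides
    have bbKey : ∀ n ∈ Icc 1 B, ((sol (m + 1) f B t j w).filter fun v => v 0 = n).card =
        if n * (f 0).1 ≤ t ∧ n * (f 0).2.2 ≤ j ∧ n * (f 0).2.1 ≤ w then
          cnt (List.ofFn fun i => f i.succ) (t - n * (f 0).1) (j - n * (f 0).2.2) (w - n * (f 0).2.1) else 0 := by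
      intro n hn
      rw [Finset.mem_Icc] at hn
      split_ifs with hle
      · rw [← ih (fun i => f i.succ) hf' _ _ _ (by omega)]
        apply Finset.card_nbij' (fun v => Fin.tail v) (fun u => Fin.cons n u)
        · intro v hv
          rw [Finset.mem_coe, Finset.mem_filter, sol, Finset.mem_filter, Fintype.mem_piFinset] at hv
          obtain ⟨⟨hvB, h1, h2, h3⟩, hv0⟩ := hv
          rw [Fin.sum_univ_succ, hv0] at h1 h2 h3
          rw [Finset.mem_coe, sol, Finset.mem_filter, Fintype.mem_piFinset]
          exact ⟨fun i => hvB i.succ, by simp only [Fin.tail]; omega, by simp only [Fin.tail]; omega,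
            by simp only [Fin.tail]; omega⟩
        · intro u hu
          rw [Finset.mem_coe, sol, Finset.mem_filter, Fintype.mem_piFinset] at hu
          obtain ⟨huB, h1, h2, h3⟩ := hu
          rw [Finset.mem_coe, Finset.mem_filter, sol, Finset.mem_filter, Fintype.mem_piFinset]
          refine ⟨⟨fun i => ?_, ?_, ?_, ?_⟩, by simp⟩
          · refine Fin.cases ?_ (fun i => ?_) i
            · simp only [Fin.cons_zero, Finset.mem_Icc]; omega
            · simp only [Fin.cons_succ]; exact huB i
          · rw [Fin.sum_univ_succ]; simp only [Fin.cons_zero, Fin.cons_succ]; omega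
          · rw [Fin.sum_univ_succ]; simp only [Fin.cons_zero, Fin.cons_succ]; omega
          · rw [Fin.sum_univ_succ]; simp only [Fin.cons_zero, Fin.cons_succ]; omega
        · intro v hv
          rw [Finset.mem_coe, Finset.mem_filter] at hv
          rw [← hv.2]; exact Fin.cons_self_tail (α := fun _ => ℕ) v
        · intro u _; exact Fin.tail_cons (α := fun _ => ℕ) n u
      · rw [Finset.card_eq_zero, Finset.filter_eq_empty_iff]
        intro v hv hv0
        rw [sol, Finset.mem_filter, Fintype.mem_piFinset] at hv
        obtain ⟨-, h1, h2, h3⟩ := hv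
        rw [Fin.sum_univ_succ, hv0] at h1 h2 h3
        apply hle
        refine ⟨?_, ?_, ?_⟩
        · have := Finset.sum_nonneg (s := (Finset.univ : Finset (Fin m))) (f := fun i => v i.succ * (f i.succ).1)
            (fun _ _ => Nat.zero_le _); omega
        · have := Finset.sum_nonneg (s := (Finset.univ : Finset (Fin m))) (f := fun i => v i.succ * (f i.succ).2.2)
            (fun _ _ => Nat.zero_le _); omega
        · have := Finset.sum_nonneg (s := (Finset.univ : Finset (Fin m))) (f := fun i => v i.succ * (f i.succ).2.1)
            (fun _ _ => Nat.zero_le _); omega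
    rw [Finset.sum_congr rfl bbKey]
    -- restrict `Icc 1 B` to `Icc 1 (t + j)`
    symm
    apply Finset.sum_subset (Finset.Icc_subset_Icc_right hB)
    intro n hn hn'
    rw [Finset.mem_Icc] at hn hn'
    rw [if_neg]
    rintro ⟨h1, h2, -⟩
    have := hf 0
    rcases Nat.eq_zero_or_pos (f 0).1 with h0 | hpos
    · have he : 1 ≤ (f 0).2.2 := by omega
      have : n ≤ n * (f 0).2.2 := Nat.le_mul_of_pos_right n he
      omega
    · have : n ≤ n * (f 0).1 := Nat.le_mul_of_pos_right n hpos
      omega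

/-- The weight of the gap `i` of a pattern: `(aᵢ, bᵢ, eᵢ)`. [cite: Rechnitzer2006Haruspicy2, Lemma 21] -/
def wt (P : LPat) (i : ℕ) : Wt := (wa P i, wb P i, we P i)

/-- The list of gap weights of a pattern. [cite: Rechnitzer2006Haruspicy2, Lemma 21] -/
def weights (P : LPat) : List Wt := List.ofFn fun i : Fin (ngaps P) => wt P i

/-- Every gap weight of a valid pattern has `a + e ≥ 1` (a unit of any gap raises `t` or `x`).
[folklore] -/
theorem wt_pos {P : LPat} (hP : P ∈ validPats) {i : ℕ} (hi : i < ngaps P) : 1 ≤ (wt P i).1 + (wt P i).2.2 := by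
  have h := cov_eq_of_mem hP (i := i) hi
  simp only [wt]; omega

/-- **The gap vectors of `SAPBuildingBlocksPatterns` are counted by `cnt`.**
[cite: Rechnitzer2006Haruspicy2, Lemma 21] -/
theorem card_gapVecs {P : LPat} (hP : P ∈ validPats) (t j w : ℕ) :
    (gapVecs P (2 * (j + t)) (j + t) t w).card = cnt (weights P) t j w := by
  rw [weights, ← card_sol (ngaps P) (fun i => wt P i) (fun i => wt_pos hP i.isLt) (2 * (j + t)) t j w (by omega)]
  congr 1
  rw [gapVecs, sol]
  refine Finset.filter_congr fun v _ => ?_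
  simp only [wt]
  constructor
  · rintro ⟨h1, h2, h3⟩; exact ⟨h1, by omega, h2⟩
  · rintro ⟨h1, h2, h3⟩; exact ⟨h1, h3, by omega⟩

/-- **The coefficients of `bbSeries`**: `[tᵗ xʲ sʷ] 𝒯 = bb(j + t, t, w)`. [cite: Rechnitzer2006Haruspicy2, Lemma 21] -/
theorem c3_bbSeries (t j w : ℕ) : c3 bbSeries t j w = bbCount (j + t) t w := by
  rw [c3, bbSeries, PowerSeries.coeff_mk, bbGF, PowerSeries.coeff_mk, coeff_sum_C_mul_X_pow]
  split_ifs with h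
  · rfl
  · rw [bbCount_eq_zero_of_lt (by omega)]; rfl

/-- **`bbSeries` is the sum of the pattern series** over the valid labelled patterns.
[cite: Rechnitzer2006Haruspicy2, Lemma 21] -/
theorem bbSeries_eq_sum : bbSeries = ∑ P ∈ validPats.toFinset, S (weights P) := by
  apply ext3
  intro t j w
  rw [c3_bbSeries, c3_sum, bbCount_eq_card_bbWords, card_bbWords_eq_sum, Nat.cast_sum]
  refine Finset.sum_congr rfl fun P hP => ?_
  rw [List.mem_toFinset] at hP
  rw [c3_S (fun μ hμ => ?_), ← card_gapVecs hP]
  rw [weights, List.mem_ofFn] at hμ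
  obtain ⟨i, rfl⟩ := hμ
  exact wt_pos hP i.isLt

end Solutions

/-! ### Clearing denominators: the five weight types and the bbKey of a pattern -/

section Keys

/-- The five gap weights that occur: `t, st, stx, x, sx` (as `(a, b, e)`). [cite: Rechnitzer2006Haruspicy2, Lemma 21] -/
def fiveL : List Wt := [(1, 0, 0), (1, 1, 0), (1, 1, 1), (0, 0, 1), (0, 1, 1)]

/-- The bbKey of a pattern: the multiplicities `(p, q, r, u, v)` of the five weight types among its
gaps. [cite: Rechnitzer2006Haruspicy2, Lemma 21] -/
def bbKey (P : LPat) : ℕ × ℕ × ℕ × ℕ × ℕ :=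
  ((weights P).count (1, 0, 0), (weights P).count (1, 1, 0), (weights P).count (1, 1, 1),
    (weights P).count (0, 0, 1), (weights P).count (0, 1, 1))

/-- Keys `1`–`25` of the key table (data). [cite: Rechnitzer2006Haruspicy2, Lemma 21] -/
def certChunk1 : List ((ℕ × ℕ × ℕ × ℕ × ℕ) × ℕ) :=
  [((0, 1, 0, 0, 2), 2),
   ((0, 1, 0, 0, 3), 8),
   ((0, 1, 0, 0, 4), 12),
   ((0, 1, 0, 0, 5), 8),
   ((0, 1, 0, 0, 6), 2),
   ((0, 1, 0, 1, 2), 4),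
   ((0, 1, 0, 1, 3), 12),
   ((0, 1, 0, 1, 4), 12),
   ((0, 1, 0, 1, 5), 4),
   ((0, 1, 0, 2, 2), 2),
   ((0, 1, 0, 2, 3), 4),
   ((0, 1, 0, 2, 4), 2),
   ((0, 1, 1, 0, 2), 4),
   ((0, 1, 1, 0, 3), 12),
   ((0, 1, 1, 0, 4), 12),
   ((0, 1, 1, 0, 5), 4),
   ((0, 1, 1, 1, 2), 6),
   ((0, 1, 1, 1, 3), 12),
   ((0, 1, 1, 1, 4), 6),
   ((0, 1, 1, 2, 2), 2),
   ((0, 1, 1, 2, 3), 2),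
   ((0, 1, 2, 0, 2), 2),
   ((0, 1, 2, 0, 3), 4),
   ((0, 1, 2, 0, 4), 2),
   ((0, 1, 2, 1, 2), 2)]

/-- Keys `26`–`50` of the key table (data). [cite: Rechnitzer2006Haruspicy2, Lemma 21] -/
def certChunk2 : List ((ℕ × ℕ × ℕ × ℕ × ℕ) × ℕ) :=
  [((0, 1, 2, 1, 3), 2),
   ((1, 0, 0, 0, 3), 2),
   ((1, 0, 0, 0, 4), 2),
   ((1, 0, 0, 1, 3), 6),
   ((1, 0, 0, 1, 4), 4),
   ((1, 0, 0, 2, 3), 6),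
   ((1, 0, 0, 2, 4), 2),
   ((1, 0, 0, 3, 3), 2),
   ((1, 1, 0, 0, 2), 4),
   ((1, 1, 0, 0, 3), 8),
   ((1, 1, 0, 0, 4), 4),
   ((1, 1, 0, 1, 2), 6),
   ((1, 1, 0, 1, 3), 8),
   ((1, 1, 0, 1, 4), 2),
   ((1, 1, 0, 2, 2), 2),
   ((1, 1, 0, 2, 3), 2),
   ((1, 1, 1, 0, 2), 6),
   ((1, 1, 1, 0, 3), 8),
   ((1, 1, 1, 0, 4), 2),
   ((1, 1, 1, 1, 2), 8),
   ((1, 1, 1, 1, 3), 4),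
   ((1, 1, 1, 2, 2), 2),
   ((1, 1, 2, 0, 2), 2),
   ((1, 1, 2, 0, 3), 2),
   ((1, 1, 2, 1, 2), 2)]

/-- Keys `51`–`75` of the key table (data). [cite: Rechnitzer2006Haruspicy2, Lemma 21] -/
def certChunk3 : List ((ℕ × ℕ × ℕ × ℕ × ℕ) × ℕ) :=
  [((2, 0, 0, 0, 3), 2),
   ((2, 0, 0, 0, 4), 2),
   ((2, 0, 0, 1, 3), 4),
   ((2, 0, 0, 1, 4), 2),
   ((2, 0, 0, 2, 3), 2),
   ((2, 1, 0, 0, 0), 2),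
   ((2, 1, 0, 0, 1), 4),
   ((2, 1, 0, 0, 2), 4),
   ((2, 1, 0, 0, 3), 4),
   ((2, 1, 0, 0, 4), 2),
   ((2, 1, 0, 1, 0), 4),
   ((2, 1, 0, 1, 1), 6),
   ((2, 1, 0, 1, 2), 4),
   ((2, 1, 0, 1, 3), 2),
   ((2, 1, 0, 2, 0), 2),
   ((2, 1, 0, 2, 1), 2),
   ((2, 1, 1, 0, 0), 4),
   ((2, 1, 1, 0, 1), 6),
   ((2, 1, 1, 0, 2), 4),
   ((2, 1, 1, 0, 3), 2),
   ((2, 1, 1, 1, 0), 6),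
   ((2, 1, 1, 1, 1), 8),
   ((2, 1, 1, 1, 2), 4),
   ((2, 1, 1, 2, 0), 2),
   ((2, 1, 1, 2, 1), 2)]

/-- Keys `76`–`100` of the key table (data). [cite: Rechnitzer2006Haruspicy2, Lemma 21] -/
def certChunk4 : List ((ℕ × ℕ × ℕ × ℕ × ℕ) × ℕ) :=
  [((2, 1, 2, 0, 0), 2),
   ((2, 1, 2, 0, 1), 2),
   ((2, 1, 2, 1, 0), 2),
   ((2, 1, 2, 1, 1), 2),
   ((3, 0, 0, 0, 1), 2),
   ((3, 0, 0, 0, 2), 2),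
   ((3, 0, 0, 1, 1), 6),
   ((3, 0, 0, 1, 2), 4),
   ((3, 0, 0, 2, 1), 6),
   ((3, 0, 0, 2, 2), 2),
   ((3, 0, 0, 3, 1), 2),
   ((3, 1, 0, 0, 0), 8),
   ((3, 1, 0, 0, 1), 8),
   ((3, 1, 0, 0, 2), 4),
   ((3, 1, 0, 1, 0), 12),
   ((3, 1, 0, 1, 1), 8),
   ((3, 1, 0, 1, 2), 2),
   ((3, 1, 0, 2, 0), 4),
   ((3, 1, 0, 2, 1), 2),
   ((3, 1, 1, 0, 0), 12),
   ((3, 1, 1, 0, 1), 8),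
   ((3, 1, 1, 0, 2), 2),
   ((3, 1, 1, 1, 0), 12),
   ((3, 1, 1, 1, 1), 4),
   ((3, 1, 1, 2, 0), 2)]

/-- Keys `101`–`122` of the key table (data). [cite: Rechnitzer2006Haruspicy2, Lemma 21] -/
def certChunk5 : List ((ℕ × ℕ × ℕ × ℕ × ℕ) × ℕ) :=
  [((3, 1, 2, 0, 0), 4),
   ((3, 1, 2, 0, 1), 2),
   ((3, 1, 2, 1, 0), 2),
   ((4, 0, 0, 0, 1), 2),
   ((4, 0, 0, 0, 2), 2),
   ((4, 0, 0, 1, 1), 4),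
   ((4, 0, 0, 1, 2), 2),
   ((4, 0, 0, 2, 1), 2),
   ((4, 1, 0, 0, 0), 12),
   ((4, 1, 0, 0, 1), 4),
   ((4, 1, 0, 0, 2), 2),
   ((4, 1, 0, 1, 0), 12),
   ((4, 1, 0, 1, 1), 2),
   ((4, 1, 0, 2, 0), 2),
   ((4, 1, 1, 0, 0), 12),
   ((4, 1, 1, 0, 1), 2),
   ((4, 1, 1, 1, 0), 6),
   ((4, 1, 2, 0, 0), 2),
   ((5, 1, 0, 0, 0), 8),
   ((5, 1, 0, 1, 0), 4),
   ((5, 1, 1, 0, 0), 4),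
   ((6, 1, 0, 0, 0), 2)]

/-- The cleared terms of `certChunk1`, spelled out (data). [cite: Rechnitzer2006Haruspicy2, Lemma 21] -/
def certPart1 {R : Type*} [CommRing R] (s x t : R) : R :=
      (2 : R) * ((1 - t) ^ (6 : ℕ) * (s * t) ^ (1 : ℕ) * (1 - s * x * t) ^ (2 : ℕ) * (1 - x) ^ (3 : ℕ) * (s * x) ^ (2 : ℕ) * (1 - s * x) ^ (4 : ℕ))
    + (8 : R) * ((1 - t) ^ (6 : ℕ) * (s * t) ^ (1 : ℕ) * (1 - s * x * t) ^ (2 : ℕ) * (1 - x) ^ (3 : ℕ) * (s * x) ^ (3 : ℕ) * (1 - s * x) ^ (3 : ℕ))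
    + (12 : R) * ((1 - t) ^ (6 : ℕ) * (s * t) ^ (1 : ℕ) * (1 - s * x * t) ^ (2 : ℕ) * (1 - x) ^ (3 : ℕ) * (s * x) ^ (4 : ℕ) * (1 - s * x) ^ (2 : ℕ))
    + (8 : R) * ((1 - t) ^ (6 : ℕ) * (s * t) ^ (1 : ℕ) * (1 - s * x * t) ^ (2 : ℕ) * (1 - x) ^ (3 : ℕ) * (s * x) ^ (5 : ℕ) * (1 - s * x) ^ (1 : ℕ))
    + (2 : R) * ((1 - t) ^ (6 : ℕ) * (s * t) ^ (1 : ℕ) * (1 - s * x * t) ^ (2 : ℕ) * (1 - x) ^ (3 : ℕ) * (s * x) ^ (6 : ℕ))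
    + (4 : R) * ((1 - t) ^ (6 : ℕ) * (s * t) ^ (1 : ℕ) * (1 - s * x * t) ^ (2 : ℕ) * x ^ (1 : ℕ) * (1 - x) ^ (2 : ℕ) * (s * x) ^ (2 : ℕ) * (1 - s * x) ^ (4 : ℕ))
    + (12 : R) * ((1 - t) ^ (6 : ℕ) * (s * t) ^ (1 : ℕ) * (1 - s * x * t) ^ (2 : ℕ) * x ^ (1 : ℕ) * (1 - x) ^ (2 : ℕ) * (s * x) ^ (3 : ℕ) * (1 - s * x) ^ (3 : ℕ))
    + (12 : R) * ((1 - t) ^ (6 : ℕ) * (s * t) ^ (1 : ℕ) * (1 - s * x * t) ^ (2 : ℕ) * x ^ (1 : ℕ) * (1 - x) ^ (2 : ℕ) * (s * x) ^ (4 : ℕ) * (1 - s * x) ^ (2 : ℕ))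
    + (4 : R) * ((1 - t) ^ (6 : ℕ) * (s * t) ^ (1 : ℕ) * (1 - s * x * t) ^ (2 : ℕ) * x ^ (1 : ℕ) * (1 - x) ^ (2 : ℕ) * (s * x) ^ (5 : ℕ) * (1 - s * x) ^ (1 : ℕ))
    + (2 : R) * ((1 - t) ^ (6 : ℕ) * (s * t) ^ (1 : ℕ) * (1 - s * x * t) ^ (2 : ℕ) * x ^ (2 : ℕ) * (1 - x) ^ (1 : ℕ) * (s * x) ^ (2 : ℕ) * (1 - s * x) ^ (4 : ℕ))
    + (4 : R) * ((1 - t) ^ (6 : ℕ) * (s * t) ^ (1 : ℕ) * (1 - s * x * t) ^ (2 : ℕ) * x ^ (2 : ℕ) * (1 - x) ^ (1 : ℕ) * (s * x) ^ (3 : ℕ) * (1 - s * x) ^ (3 : ℕ))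
    + (2 : R) * ((1 - t) ^ (6 : ℕ) * (s * t) ^ (1 : ℕ) * (1 - s * x * t) ^ (2 : ℕ) * x ^ (2 : ℕ) * (1 - x) ^ (1 : ℕ) * (s * x) ^ (4 : ℕ) * (1 - s * x) ^ (2 : ℕ))
    + (4 : R) * ((1 - t) ^ (6 : ℕ) * (s * t) ^ (1 : ℕ) * (s * x * t) ^ (1 : ℕ) * (1 - s * x * t) ^ (1 : ℕ) * (1 - x) ^ (3 : ℕ) * (s * x) ^ (2 : ℕ) * (1 - s * x) ^ (4 : ℕ))
    + (12 : R) * ((1 - t) ^ (6 : ℕ) * (s * t) ^ (1 : ℕ) * (s * x * t) ^ (1 : ℕ) * (1 - s * x * t) ^ (1 : ℕ) * (1 - x) ^ (3 : ℕ) * (s * x) ^ (3 : ℕ) * (1 - s * x) ^ (3 : ℕ))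
    + (12 : R) * ((1 - t) ^ (6 : ℕ) * (s * t) ^ (1 : ℕ) * (s * x * t) ^ (1 : ℕ) * (1 - s * x * t) ^ (1 : ℕ) * (1 - x) ^ (3 : ℕ) * (s * x) ^ (4 : ℕ) * (1 - s * x) ^ (2 : ℕ))
    + (4 : R) * ((1 - t) ^ (6 : ℕ) * (s * t) ^ (1 : ℕ) * (s * x * t) ^ (1 : ℕ) * (1 - s * x * t) ^ (1 : ℕ) * (1 - x) ^ (3 : ℕ) * (s * x) ^ (5 : ℕ) * (1 - s * x) ^ (1 : ℕ))
    + (6 : R) * ((1 - t) ^ (6 : ℕ) * (s * t) ^ (1 : ℕ) * (s * x * t) ^ (1 : ℕ) * (1 - s * x * t) ^ (1 : ℕ) * x ^ (1 : ℕ) * (1 - x) ^ (2 : ℕ) * (s * x) ^ (2 : ℕ) * (1 - s * x) ^ (4 : ℕ))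
    + (12 : R) * ((1 - t) ^ (6 : ℕ) * (s * t) ^ (1 : ℕ) * (s * x * t) ^ (1 : ℕ) * (1 - s * x * t) ^ (1 : ℕ) * x ^ (1 : ℕ) * (1 - x) ^ (2 : ℕ) * (s * x) ^ (3 : ℕ) * (1 - s * x) ^ (3 : ℕ))
    + (6 : R) * ((1 - t) ^ (6 : ℕ) * (s * t) ^ (1 : ℕ) * (s * x * t) ^ (1 : ℕ) * (1 - s * x * t) ^ (1 : ℕ) * x ^ (1 : ℕ) * (1 - x) ^ (2 : ℕ) * (s * x) ^ (4 : ℕ) * (1 - s * x) ^ (2 : ℕ))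
    + (2 : R) * ((1 - t) ^ (6 : ℕ) * (s * t) ^ (1 : ℕ) * (s * x * t) ^ (1 : ℕ) * (1 - s * x * t) ^ (1 : ℕ) * x ^ (2 : ℕ) * (1 - x) ^ (1 : ℕ) * (s * x) ^ (2 : ℕ) * (1 - s * x) ^ (4 : ℕ))
    + (2 : R) * ((1 - t) ^ (6 : ℕ) * (s * t) ^ (1 : ℕ) * (s * x * t) ^ (1 : ℕ) * (1 - s * x * t) ^ (1 : ℕ) * x ^ (2 : ℕ) * (1 - x) ^ (1 : ℕ) * (s * x) ^ (3 : ℕ) * (1 - s * x) ^ (3 : ℕ))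
    + (2 : R) * ((1 - t) ^ (6 : ℕ) * (s * t) ^ (1 : ℕ) * (s * x * t) ^ (2 : ℕ) * (1 - x) ^ (3 : ℕ) * (s * x) ^ (2 : ℕ) * (1 - s * x) ^ (4 : ℕ))
    + (4 : R) * ((1 - t) ^ (6 : ℕ) * (s * t) ^ (1 : ℕ) * (s * x * t) ^ (2 : ℕ) * (1 - x) ^ (3 : ℕ) * (s * x) ^ (3 : ℕ) * (1 - s * x) ^ (3 : ℕ))
    + (2 : R) * ((1 - t) ^ (6 : ℕ) * (s * t) ^ (1 : ℕ) * (s * x * t) ^ (2 : ℕ) * (1 - x) ^ (3 : ℕ) * (s * x) ^ (4 : ℕ) * (1 - s * x) ^ (2 : ℕ))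
    + (2 : R) * ((1 - t) ^ (6 : ℕ) * (s * t) ^ (1 : ℕ) * (s * x * t) ^ (2 : ℕ) * x ^ (1 : ℕ) * (1 - x) ^ (2 : ℕ) * (s * x) ^ (2 : ℕ) * (1 - s * x) ^ (4 : ℕ))

/-- The cleared terms of `certChunk2`, spelled out (data). [cite: Rechnitzer2006Haruspicy2, Lemma 21] -/
def certPart2 {R : Type*} [CommRing R] (s x t : R) : R :=
      (2 : R) * ((1 - t) ^ (6 : ℕ) * (s * t) ^ (1 : ℕ) * (s * x * t) ^ (2 : ℕ) * x ^ (1 : ℕ) * (1 - x) ^ (2 : ℕ) * (s * x) ^ (3 : ℕ) * (1 - s * x) ^ (3 : ℕ))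
    + (2 : R) * (t ^ (1 : ℕ) * (1 - t) ^ (5 : ℕ) * (1 - s * t) ^ (1 : ℕ) * (1 - s * x * t) ^ (2 : ℕ) * (1 - x) ^ (3 : ℕ) * (s * x) ^ (3 : ℕ) * (1 - s * x) ^ (3 : ℕ))
    + (2 : R) * (t ^ (1 : ℕ) * (1 - t) ^ (5 : ℕ) * (1 - s * t) ^ (1 : ℕ) * (1 - s * x * t) ^ (2 : ℕ) * (1 - x) ^ (3 : ℕ) * (s * x) ^ (4 : ℕ) * (1 - s * x) ^ (2 : ℕ))
    + (6 : R) * (t ^ (1 : ℕ) * (1 - t) ^ (5 : ℕ) * (1 - s * t) ^ (1 : ℕ) * (1 - s * x * t) ^ (2 : ℕ) * x ^ (1 : ℕ) * (1 - x) ^ (2 : ℕ) * (s * x) ^ (3 : ℕ) * (1 - s * x) ^ (3 : ℕ))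
    + (4 : R) * (t ^ (1 : ℕ) * (1 - t) ^ (5 : ℕ) * (1 - s * t) ^ (1 : ℕ) * (1 - s * x * t) ^ (2 : ℕ) * x ^ (1 : ℕ) * (1 - x) ^ (2 : ℕ) * (s * x) ^ (4 : ℕ) * (1 - s * x) ^ (2 : ℕ))
    + (6 : R) * (t ^ (1 : ℕ) * (1 - t) ^ (5 : ℕ) * (1 - s * t) ^ (1 : ℕ) * (1 - s * x * t) ^ (2 : ℕ) * x ^ (2 : ℕ) * (1 - x) ^ (1 : ℕ) * (s * x) ^ (3 : ℕ) * (1 - s * x) ^ (3 : ℕ))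
    + (2 : R) * (t ^ (1 : ℕ) * (1 - t) ^ (5 : ℕ) * (1 - s * t) ^ (1 : ℕ) * (1 - s * x * t) ^ (2 : ℕ) * x ^ (2 : ℕ) * (1 - x) ^ (1 : ℕ) * (s * x) ^ (4 : ℕ) * (1 - s * x) ^ (2 : ℕ))
    + (2 : R) * (t ^ (1 : ℕ) * (1 - t) ^ (5 : ℕ) * (1 - s * t) ^ (1 : ℕ) * (1 - s * x * t) ^ (2 : ℕ) * x ^ (3 : ℕ) * (s * x) ^ (3 : ℕ) * (1 - s * x) ^ (3 : ℕ))
    + (4 : R) * (t ^ (1 : ℕ) * (1 - t) ^ (5 : ℕ) * (s * t) ^ (1 : ℕ) * (1 - s * x * t) ^ (2 : ℕ) * (1 - x) ^ (3 : ℕ) * (s * x) ^ (2 : ℕ) * (1 - s * x) ^ (4 : ℕ))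
    + (8 : R) * (t ^ (1 : ℕ) * (1 - t) ^ (5 : ℕ) * (s * t) ^ (1 : ℕ) * (1 - s * x * t) ^ (2 : ℕ) * (1 - x) ^ (3 : ℕ) * (s * x) ^ (3 : ℕ) * (1 - s * x) ^ (3 : ℕ))
    + (4 : R) * (t ^ (1 : ℕ) * (1 - t) ^ (5 : ℕ) * (s * t) ^ (1 : ℕ) * (1 - s * x * t) ^ (2 : ℕ) * (1 - x) ^ (3 : ℕ) * (s * x) ^ (4 : ℕ) * (1 - s * x) ^ (2 : ℕ))
    + (6 : R) * (t ^ (1 : ℕ) * (1 - t) ^ (5 : ℕ) * (s * t) ^ (1 : ℕ) * (1 - s * x * t) ^ (2 : ℕ) * x ^ (1 : ℕ) * (1 - x) ^ (2 : ℕ) * (s * x) ^ (2 : ℕ) * (1 - s * x) ^ (4 : ℕ))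
    + (8 : R) * (t ^ (1 : ℕ) * (1 - t) ^ (5 : ℕ) * (s * t) ^ (1 : ℕ) * (1 - s * x * t) ^ (2 : ℕ) * x ^ (1 : ℕ) * (1 - x) ^ (2 : ℕ) * (s * x) ^ (3 : ℕ) * (1 - s * x) ^ (3 : ℕ))
    + (2 : R) * (t ^ (1 : ℕ) * (1 - t) ^ (5 : ℕ) * (s * t) ^ (1 : ℕ) * (1 - s * x * t) ^ (2 : ℕ) * x ^ (1 : ℕ) * (1 - x) ^ (2 : ℕ) * (s * x) ^ (4 : ℕ) * (1 - s * x) ^ (2 : ℕ))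
    + (2 : R) * (t ^ (1 : ℕ) * (1 - t) ^ (5 : ℕ) * (s * t) ^ (1 : ℕ) * (1 - s * x * t) ^ (2 : ℕ) * x ^ (2 : ℕ) * (1 - x) ^ (1 : ℕ) * (s * x) ^ (2 : ℕ) * (1 - s * x) ^ (4 : ℕ))
    + (2 : R) * (t ^ (1 : ℕ) * (1 - t) ^ (5 : ℕ) * (s * t) ^ (1 : ℕ) * (1 - s * x * t) ^ (2 : ℕ) * x ^ (2 : ℕ) * (1 - x) ^ (1 : ℕ) * (s * x) ^ (3 : ℕ) * (1 - s * x) ^ (3 : ℕ))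
    + (6 : R) * (t ^ (1 : ℕ) * (1 - t) ^ (5 : ℕ) * (s * t) ^ (1 : ℕ) * (s * x * t) ^ (1 : ℕ) * (1 - s * x * t) ^ (1 : ℕ) * (1 - x) ^ (3 : ℕ) * (s * x) ^ (2 : ℕ) * (1 - s * x) ^ (4 : ℕ))
    + (8 : R) * (t ^ (1 : ℕ) * (1 - t) ^ (5 : ℕ) * (s * t) ^ (1 : ℕ) * (s * x * t) ^ (1 : ℕ) * (1 - s * x * t) ^ (1 : ℕ) * (1 - x) ^ (3 : ℕ) * (s * x) ^ (3 : ℕ) * (1 - s * x) ^ (3 : ℕ))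
    + (2 : R) * (t ^ (1 : ℕ) * (1 - t) ^ (5 : ℕ) * (s * t) ^ (1 : ℕ) * (s * x * t) ^ (1 : ℕ) * (1 - s * x * t) ^ (1 : ℕ) * (1 - x) ^ (3 : ℕ) * (s * x) ^ (4 : ℕ) * (1 - s * x) ^ (2 : ℕ))
    + (8 : R) * (t ^ (1 : ℕ) * (1 - t) ^ (5 : ℕ) * (s * t) ^ (1 : ℕ) * (s * x * t) ^ (1 : ℕ) * (1 - s * x * t) ^ (1 : ℕ) * x ^ (1 : ℕ) * (1 - x) ^ (2 : ℕ) * (s * x) ^ (2 : ℕ) * (1 - s * x) ^ (4 : ℕ))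
    + (4 : R) * (t ^ (1 : ℕ) * (1 - t) ^ (5 : ℕ) * (s * t) ^ (1 : ℕ) * (s * x * t) ^ (1 : ℕ) * (1 - s * x * t) ^ (1 : ℕ) * x ^ (1 : ℕ) * (1 - x) ^ (2 : ℕ) * (s * x) ^ (3 : ℕ) * (1 - s * x) ^ (3 : ℕ))
    + (2 : R) * (t ^ (1 : ℕ) * (1 - t) ^ (5 : ℕ) * (s * t) ^ (1 : ℕ) * (s * x * t) ^ (1 : ℕ) * (1 - s * x * t) ^ (1 : ℕ) * x ^ (2 : ℕ) * (1 - x) ^ (1 : ℕ) * (s * x) ^ (2 : ℕ) * (1 - s * x) ^ (4 : ℕ))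
    + (2 : R) * (t ^ (1 : ℕ) * (1 - t) ^ (5 : ℕ) * (s * t) ^ (1 : ℕ) * (s * x * t) ^ (2 : ℕ) * (1 - x) ^ (3 : ℕ) * (s * x) ^ (2 : ℕ) * (1 - s * x) ^ (4 : ℕ))
    + (2 : R) * (t ^ (1 : ℕ) * (1 - t) ^ (5 : ℕ) * (s * t) ^ (1 : ℕ) * (s * x * t) ^ (2 : ℕ) * (1 - x) ^ (3 : ℕ) * (s * x) ^ (3 : ℕ) * (1 - s * x) ^ (3 : ℕ))
    + (2 : R) * (t ^ (1 : ℕ) * (1 - t) ^ (5 : ℕ) * (s * t) ^ (1 : ℕ) * (s * x * t) ^ (2 : ℕ) * x ^ (1 : ℕ) * (1 - x) ^ (2 : ℕ) * (s * x) ^ (2 : ℕ) * (1 - s * x) ^ (4 : ℕ))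

/-- The cleared terms of `certChunk3`, spelled out (data). [cite: Rechnitzer2006Haruspicy2, Lemma 21] -/
def certPart3 {R : Type*} [CommRing R] (s x t : R) : R :=
      (2 : R) * (t ^ (2 : ℕ) * (1 - t) ^ (4 : ℕ) * (1 - s * t) ^ (1 : ℕ) * (1 - s * x * t) ^ (2 : ℕ) * (1 - x) ^ (3 : ℕ) * (s * x) ^ (3 : ℕ) * (1 - s * x) ^ (3 : ℕ))
    + (2 : R) * (t ^ (2 : ℕ) * (1 - t) ^ (4 : ℕ) * (1 - s * t) ^ (1 : ℕ) * (1 - s * x * t) ^ (2 : ℕ) * (1 - x) ^ (3 : ℕ) * (s * x) ^ (4 : ℕ) * (1 - s * x) ^ (2 : ℕ))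
    + (4 : R) * (t ^ (2 : ℕ) * (1 - t) ^ (4 : ℕ) * (1 - s * t) ^ (1 : ℕ) * (1 - s * x * t) ^ (2 : ℕ) * x ^ (1 : ℕ) * (1 - x) ^ (2 : ℕ) * (s * x) ^ (3 : ℕ) * (1 - s * x) ^ (3 : ℕ))
    + (2 : R) * (t ^ (2 : ℕ) * (1 - t) ^ (4 : ℕ) * (1 - s * t) ^ (1 : ℕ) * (1 - s * x * t) ^ (2 : ℕ) * x ^ (1 : ℕ) * (1 - x) ^ (2 : ℕ) * (s * x) ^ (4 : ℕ) * (1 - s * x) ^ (2 : ℕ))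
    + (2 : R) * (t ^ (2 : ℕ) * (1 - t) ^ (4 : ℕ) * (1 - s * t) ^ (1 : ℕ) * (1 - s * x * t) ^ (2 : ℕ) * x ^ (2 : ℕ) * (1 - x) ^ (1 : ℕ) * (s * x) ^ (3 : ℕ) * (1 - s * x) ^ (3 : ℕ))
    + (2 : R) * (t ^ (2 : ℕ) * (1 - t) ^ (4 : ℕ) * (s * t) ^ (1 : ℕ) * (1 - s * x * t) ^ (2 : ℕ) * (1 - x) ^ (3 : ℕ) * (1 - s * x) ^ (6 : ℕ))
    + (4 : R) * (t ^ (2 : ℕ) * (1 - t) ^ (4 : ℕ) * (s * t) ^ (1 : ℕ) * (1 - s * x * t) ^ (2 : ℕ) * (1 - x) ^ (3 : ℕ) * (s * x) ^ (1 : ℕ) * (1 - s * x) ^ (5 : ℕ))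
    + (4 : R) * (t ^ (2 : ℕ) * (1 - t) ^ (4 : ℕ) * (s * t) ^ (1 : ℕ) * (1 - s * x * t) ^ (2 : ℕ) * (1 - x) ^ (3 : ℕ) * (s * x) ^ (2 : ℕ) * (1 - s * x) ^ (4 : ℕ))
    + (4 : R) * (t ^ (2 : ℕ) * (1 - t) ^ (4 : ℕ) * (s * t) ^ (1 : ℕ) * (1 - s * x * t) ^ (2 : ℕ) * (1 - x) ^ (3 : ℕ) * (s * x) ^ (3 : ℕ) * (1 - s * x) ^ (3 : ℕ))
    + (2 : R) * (t ^ (2 : ℕ) * (1 - t) ^ (4 : ℕ) * (s * t) ^ (1 : ℕ) * (1 - s * x * t) ^ (2 : ℕ) * (1 - x) ^ (3 : ℕ) * (s * x) ^ (4 : ℕ) * (1 - s * x) ^ (2 : ℕ))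
    + (4 : R) * (t ^ (2 : ℕ) * (1 - t) ^ (4 : ℕ) * (s * t) ^ (1 : ℕ) * (1 - s * x * t) ^ (2 : ℕ) * x ^ (1 : ℕ) * (1 - x) ^ (2 : ℕ) * (1 - s * x) ^ (6 : ℕ))
    + (6 : R) * (t ^ (2 : ℕ) * (1 - t) ^ (4 : ℕ) * (s * t) ^ (1 : ℕ) * (1 - s * x * t) ^ (2 : ℕ) * x ^ (1 : ℕ) * (1 - x) ^ (2 : ℕ) * (s * x) ^ (1 : ℕ) * (1 - s * x) ^ (5 : ℕ))
    + (4 : R) * (t ^ (2 : ℕ) * (1 - t) ^ (4 : ℕ) * (s * t) ^ (1 : ℕ) * (1 - s * x * t) ^ (2 : ℕ) * x ^ (1 : ℕ) * (1 - x) ^ (2 : ℕ) * (s * x) ^ (2 : ℕ) * (1 - s * x) ^ (4 : ℕ))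
    + (2 : R) * (t ^ (2 : ℕ) * (1 - t) ^ (4 : ℕ) * (s * t) ^ (1 : ℕ) * (1 - s * x * t) ^ (2 : ℕ) * x ^ (1 : ℕ) * (1 - x) ^ (2 : ℕ) * (s * x) ^ (3 : ℕ) * (1 - s * x) ^ (3 : ℕ))
    + (2 : R) * (t ^ (2 : ℕ) * (1 - t) ^ (4 : ℕ) * (s * t) ^ (1 : ℕ) * (1 - s * x * t) ^ (2 : ℕ) * x ^ (2 : ℕ) * (1 - x) ^ (1 : ℕ) * (1 - s * x) ^ (6 : ℕ))
    + (2 : R) * (t ^ (2 : ℕ) * (1 - t) ^ (4 : ℕ) * (s * t) ^ (1 : ℕ) * (1 - s * x * t) ^ (2 : ℕ) * x ^ (2 : ℕ) * (1 - x) ^ (1 : ℕ) * (s * x) ^ (1 : ℕ) * (1 - s * x) ^ (5 : ℕ))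
    + (4 : R) * (t ^ (2 : ℕ) * (1 - t) ^ (4 : ℕ) * (s * t) ^ (1 : ℕ) * (s * x * t) ^ (1 : ℕ) * (1 - s * x * t) ^ (1 : ℕ) * (1 - x) ^ (3 : ℕ) * (1 - s * x) ^ (6 : ℕ))
    + (6 : R) * (t ^ (2 : ℕ) * (1 - t) ^ (4 : ℕ) * (s * t) ^ (1 : ℕ) * (s * x * t) ^ (1 : ℕ) * (1 - s * x * t) ^ (1 : ℕ) * (1 - x) ^ (3 : ℕ) * (s * x) ^ (1 : ℕ) * (1 - s * x) ^ (5 : ℕ))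
    + (4 : R) * (t ^ (2 : ℕ) * (1 - t) ^ (4 : ℕ) * (s * t) ^ (1 : ℕ) * (s * x * t) ^ (1 : ℕ) * (1 - s * x * t) ^ (1 : ℕ) * (1 - x) ^ (3 : ℕ) * (s * x) ^ (2 : ℕ) * (1 - s * x) ^ (4 : ℕ))
    + (2 : R) * (t ^ (2 : ℕ) * (1 - t) ^ (4 : ℕ) * (s * t) ^ (1 : ℕ) * (s * x * t) ^ (1 : ℕ) * (1 - s * x * t) ^ (1 : ℕ) * (1 - x) ^ (3 : ℕ) * (s * x) ^ (3 : ℕ) * (1 - s * x) ^ (3 : ℕ))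
    + (6 : R) * (t ^ (2 : ℕ) * (1 - t) ^ (4 : ℕ) * (s * t) ^ (1 : ℕ) * (s * x * t) ^ (1 : ℕ) * (1 - s * x * t) ^ (1 : ℕ) * x ^ (1 : ℕ) * (1 - x) ^ (2 : ℕ) * (1 - s * x) ^ (6 : ℕ))
    + (8 : R) * (t ^ (2 : ℕ) * (1 - t) ^ (4 : ℕ) * (s * t) ^ (1 : ℕ) * (s * x * t) ^ (1 : ℕ) * (1 - s * x * t) ^ (1 : ℕ) * x ^ (1 : ℕ) * (1 - x) ^ (2 : ℕ) * (s * x) ^ (1 : ℕ) * (1 - s * x) ^ (5 : ℕ))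
    + (4 : R) * (t ^ (2 : ℕ) * (1 - t) ^ (4 : ℕ) * (s * t) ^ (1 : ℕ) * (s * x * t) ^ (1 : ℕ) * (1 - s * x * t) ^ (1 : ℕ) * x ^ (1 : ℕ) * (1 - x) ^ (2 : ℕ) * (s * x) ^ (2 : ℕ) * (1 - s * x) ^ (4 : ℕ))
    + (2 : R) * (t ^ (2 : ℕ) * (1 - t) ^ (4 : ℕ) * (s * t) ^ (1 : ℕ) * (s * x * t) ^ (1 : ℕ) * (1 - s * x * t) ^ (1 : ℕ) * x ^ (2 : ℕ) * (1 - x) ^ (1 : ℕ) * (1 - s * x) ^ (6 : ℕ))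
    + (2 : R) * (t ^ (2 : ℕ) * (1 - t) ^ (4 : ℕ) * (s * t) ^ (1 : ℕ) * (s * x * t) ^ (1 : ℕ) * (1 - s * x * t) ^ (1 : ℕ) * x ^ (2 : ℕ) * (1 - x) ^ (1 : ℕ) * (s * x) ^ (1 : ℕ) * (1 - s * x) ^ (5 : ℕ))

/-- The cleared terms of `certChunk4`, spelled out (data). [cite: Rechnitzer2006Haruspicy2, Lemma 21] -/
def certPart4 {R : Type*} [CommRing R] (s x t : R) : R :=
      (2 : R) * (t ^ (2 : ℕ) * (1 - t) ^ (4 : ℕ) * (s * t) ^ (1 : ℕ) * (s * x * t) ^ (2 : ℕ) * (1 - x) ^ (3 : ℕ) * (1 - s * x) ^ (6 : ℕ))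
    + (2 : R) * (t ^ (2 : ℕ) * (1 - t) ^ (4 : ℕ) * (s * t) ^ (1 : ℕ) * (s * x * t) ^ (2 : ℕ) * (1 - x) ^ (3 : ℕ) * (s * x) ^ (1 : ℕ) * (1 - s * x) ^ (5 : ℕ))
    + (2 : R) * (t ^ (2 : ℕ) * (1 - t) ^ (4 : ℕ) * (s * t) ^ (1 : ℕ) * (s * x * t) ^ (2 : ℕ) * x ^ (1 : ℕ) * (1 - x) ^ (2 : ℕ) * (1 - s * x) ^ (6 : ℕ))
    + (2 : R) * (t ^ (2 : ℕ) * (1 - t) ^ (4 : ℕ) * (s * t) ^ (1 : ℕ) * (s * x * t) ^ (2 : ℕ) * x ^ (1 : ℕ) * (1 - x) ^ (2 : ℕ) * (s * x) ^ (1 : ℕ) * (1 - s * x) ^ (5 : ℕ))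
    + (2 : R) * (t ^ (3 : ℕ) * (1 - t) ^ (3 : ℕ) * (1 - s * t) ^ (1 : ℕ) * (1 - s * x * t) ^ (2 : ℕ) * (1 - x) ^ (3 : ℕ) * (s * x) ^ (1 : ℕ) * (1 - s * x) ^ (5 : ℕ))
    + (2 : R) * (t ^ (3 : ℕ) * (1 - t) ^ (3 : ℕ) * (1 - s * t) ^ (1 : ℕ) * (1 - s * x * t) ^ (2 : ℕ) * (1 - x) ^ (3 : ℕ) * (s * x) ^ (2 : ℕ) * (1 - s * x) ^ (4 : ℕ))
    + (6 : R) * (t ^ (3 : ℕ) * (1 - t) ^ (3 : ℕ) * (1 - s * t) ^ (1 : ℕ) * (1 - s * x * t) ^ (2 : ℕ) * x ^ (1 : ℕ) * (1 - x) ^ (2 : ℕ) * (s * x) ^ (1 : ℕ) * (1 - s * x) ^ (5 : ℕ))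
    + (4 : R) * (t ^ (3 : ℕ) * (1 - t) ^ (3 : ℕ) * (1 - s * t) ^ (1 : ℕ) * (1 - s * x * t) ^ (2 : ℕ) * x ^ (1 : ℕ) * (1 - x) ^ (2 : ℕ) * (s * x) ^ (2 : ℕ) * (1 - s * x) ^ (4 : ℕ))
    + (6 : R) * (t ^ (3 : ℕ) * (1 - t) ^ (3 : ℕ) * (1 - s * t) ^ (1 : ℕ) * (1 - s * x * t) ^ (2 : ℕ) * x ^ (2 : ℕ) * (1 - x) ^ (1 : ℕ) * (s * x) ^ (1 : ℕ) * (1 - s * x) ^ (5 : ℕ))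
    + (2 : R) * (t ^ (3 : ℕ) * (1 - t) ^ (3 : ℕ) * (1 - s * t) ^ (1 : ℕ) * (1 - s * x * t) ^ (2 : ℕ) * x ^ (2 : ℕ) * (1 - x) ^ (1 : ℕ) * (s * x) ^ (2 : ℕ) * (1 - s * x) ^ (4 : ℕ))
    + (2 : R) * (t ^ (3 : ℕ) * (1 - t) ^ (3 : ℕ) * (1 - s * t) ^ (1 : ℕ) * (1 - s * x * t) ^ (2 : ℕ) * x ^ (3 : ℕ) * (s * x) ^ (1 : ℕ) * (1 - s * x) ^ (5 : ℕ))
    + (8 : R) * (t ^ (3 : ℕ) * (1 - t) ^ (3 : ℕ) * (s * t) ^ (1 : ℕ) * (1 - s * x * t) ^ (2 : ℕ) * (1 - x) ^ (3 : ℕ) * (1 - s * x) ^ (6 : ℕ))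
    + (8 : R) * (t ^ (3 : ℕ) * (1 - t) ^ (3 : ℕ) * (s * t) ^ (1 : ℕ) * (1 - s * x * t) ^ (2 : ℕ) * (1 - x) ^ (3 : ℕ) * (s * x) ^ (1 : ℕ) * (1 - s * x) ^ (5 : ℕ))
    + (4 : R) * (t ^ (3 : ℕ) * (1 - t) ^ (3 : ℕ) * (s * t) ^ (1 : ℕ) * (1 - s * x * t) ^ (2 : ℕ) * (1 - x) ^ (3 : ℕ) * (s * x) ^ (2 : ℕ) * (1 - s * x) ^ (4 : ℕ))
    + (12 : R) * (t ^ (3 : ℕ) * (1 - t) ^ (3 : ℕ) * (s * t) ^ (1 : ℕ) * (1 - s * x * t) ^ (2 : ℕ) * x ^ (1 : ℕ) * (1 - x) ^ (2 : ℕ) * (1 - s * x) ^ (6 : ℕ))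
    + (8 : R) * (t ^ (3 : ℕ) * (1 - t) ^ (3 : ℕ) * (s * t) ^ (1 : ℕ) * (1 - s * x * t) ^ (2 : ℕ) * x ^ (1 : ℕ) * (1 - x) ^ (2 : ℕ) * (s * x) ^ (1 : ℕ) * (1 - s * x) ^ (5 : ℕ))
    + (2 : R) * (t ^ (3 : ℕ) * (1 - t) ^ (3 : ℕ) * (s * t) ^ (1 : ℕ) * (1 - s * x * t) ^ (2 : ℕ) * x ^ (1 : ℕ) * (1 - x) ^ (2 : ℕ) * (s * x) ^ (2 : ℕ) * (1 - s * x) ^ (4 : ℕ))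
    + (4 : R) * (t ^ (3 : ℕ) * (1 - t) ^ (3 : ℕ) * (s * t) ^ (1 : ℕ) * (1 - s * x * t) ^ (2 : ℕ) * x ^ (2 : ℕ) * (1 - x) ^ (1 : ℕ) * (1 - s * x) ^ (6 : ℕ))
    + (2 : R) * (t ^ (3 : ℕ) * (1 - t) ^ (3 : ℕ) * (s * t) ^ (1 : ℕ) * (1 - s * x * t) ^ (2 : ℕ) * x ^ (2 : ℕ) * (1 - x) ^ (1 : ℕ) * (s * x) ^ (1 : ℕ) * (1 - s * x) ^ (5 : ℕ))
    + (12 : R) * (t ^ (3 : ℕ) * (1 - t) ^ (3 : ℕ) * (s * t) ^ (1 : ℕ) * (s * x * t) ^ (1 : ℕ) * (1 - s * x * t) ^ (1 : ℕ) * (1 - x) ^ (3 : ℕ) * (1 - s * x) ^ (6 : ℕ))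
    + (8 : R) * (t ^ (3 : ℕ) * (1 - t) ^ (3 : ℕ) * (s * t) ^ (1 : ℕ) * (s * x * t) ^ (1 : ℕ) * (1 - s * x * t) ^ (1 : ℕ) * (1 - x) ^ (3 : ℕ) * (s * x) ^ (1 : ℕ) * (1 - s * x) ^ (5 : ℕ))
    + (2 : R) * (t ^ (3 : ℕ) * (1 - t) ^ (3 : ℕ) * (s * t) ^ (1 : ℕ) * (s * x * t) ^ (1 : ℕ) * (1 - s * x * t) ^ (1 : ℕ) * (1 - x) ^ (3 : ℕ) * (s * x) ^ (2 : ℕ) * (1 - s * x) ^ (4 : ℕ))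
    + (12 : R) * (t ^ (3 : ℕ) * (1 - t) ^ (3 : ℕ) * (s * t) ^ (1 : ℕ) * (s * x * t) ^ (1 : ℕ) * (1 - s * x * t) ^ (1 : ℕ) * x ^ (1 : ℕ) * (1 - x) ^ (2 : ℕ) * (1 - s * x) ^ (6 : ℕ))
    + (4 : R) * (t ^ (3 : ℕ) * (1 - t) ^ (3 : ℕ) * (s * t) ^ (1 : ℕ) * (s * x * t) ^ (1 : ℕ) * (1 - s * x * t) ^ (1 : ℕ) * x ^ (1 : ℕ) * (1 - x) ^ (2 : ℕ) * (s * x) ^ (1 : ℕ) * (1 - s * x) ^ (5 : ℕ))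
    + (2 : R) * (t ^ (3 : ℕ) * (1 - t) ^ (3 : ℕ) * (s * t) ^ (1 : ℕ) * (s * x * t) ^ (1 : ℕ) * (1 - s * x * t) ^ (1 : ℕ) * x ^ (2 : ℕ) * (1 - x) ^ (1 : ℕ) * (1 - s * x) ^ (6 : ℕ))

/-- The cleared terms of `certChunk5`, spelled out (data). [cite: Rechnitzer2006Haruspicy2, Lemma 21] -/
def certPart5 {R : Type*} [CommRing R] (s x t : R) : R :=
      (4 : R) * (t ^ (3 : ℕ) * (1 - t) ^ (3 : ℕ) * (s * t) ^ (1 : ℕ) * (s * x * t) ^ (2 : ℕ) * (1 - x) ^ (3 : ℕ) * (1 - s * x) ^ (6 : ℕ))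
    + (2 : R) * (t ^ (3 : ℕ) * (1 - t) ^ (3 : ℕ) * (s * t) ^ (1 : ℕ) * (s * x * t) ^ (2 : ℕ) * (1 - x) ^ (3 : ℕ) * (s * x) ^ (1 : ℕ) * (1 - s * x) ^ (5 : ℕ))
    + (2 : R) * (t ^ (3 : ℕ) * (1 - t) ^ (3 : ℕ) * (s * t) ^ (1 : ℕ) * (s * x * t) ^ (2 : ℕ) * x ^ (1 : ℕ) * (1 - x) ^ (2 : ℕ) * (1 - s * x) ^ (6 : ℕ))
    + (2 : R) * (t ^ (4 : ℕ) * (1 - t) ^ (2 : ℕ) * (1 - s * t) ^ (1 : ℕ) * (1 - s * x * t) ^ (2 : ℕ) * (1 - x) ^ (3 : ℕ) * (s * x) ^ (1 : ℕ) * (1 - s * x) ^ (5 : ℕ))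
    + (2 : R) * (t ^ (4 : ℕ) * (1 - t) ^ (2 : ℕ) * (1 - s * t) ^ (1 : ℕ) * (1 - s * x * t) ^ (2 : ℕ) * (1 - x) ^ (3 : ℕ) * (s * x) ^ (2 : ℕ) * (1 - s * x) ^ (4 : ℕ))
    + (4 : R) * (t ^ (4 : ℕ) * (1 - t) ^ (2 : ℕ) * (1 - s * t) ^ (1 : ℕ) * (1 - s * x * t) ^ (2 : ℕ) * x ^ (1 : ℕ) * (1 - x) ^ (2 : ℕ) * (s * x) ^ (1 : ℕ) * (1 - s * x) ^ (5 : ℕ))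
    + (2 : R) * (t ^ (4 : ℕ) * (1 - t) ^ (2 : ℕ) * (1 - s * t) ^ (1 : ℕ) * (1 - s * x * t) ^ (2 : ℕ) * x ^ (1 : ℕ) * (1 - x) ^ (2 : ℕ) * (s * x) ^ (2 : ℕ) * (1 - s * x) ^ (4 : ℕ))
    + (2 : R) * (t ^ (4 : ℕ) * (1 - t) ^ (2 : ℕ) * (1 - s * t) ^ (1 : ℕ) * (1 - s * x * t) ^ (2 : ℕ) * x ^ (2 : ℕ) * (1 - x) ^ (1 : ℕ) * (s * x) ^ (1 : ℕ) * (1 - s * x) ^ (5 : ℕ))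
    + (12 : R) * (t ^ (4 : ℕ) * (1 - t) ^ (2 : ℕ) * (s * t) ^ (1 : ℕ) * (1 - s * x * t) ^ (2 : ℕ) * (1 - x) ^ (3 : ℕ) * (1 - s * x) ^ (6 : ℕ))
    + (4 : R) * (t ^ (4 : ℕ) * (1 - t) ^ (2 : ℕ) * (s * t) ^ (1 : ℕ) * (1 - s * x * t) ^ (2 : ℕ) * (1 - x) ^ (3 : ℕ) * (s * x) ^ (1 : ℕ) * (1 - s * x) ^ (5 : ℕ))
    + (2 : R) * (t ^ (4 : ℕ) * (1 - t) ^ (2 : ℕ) * (s * t) ^ (1 : ℕ) * (1 - s * x * t) ^ (2 : ℕ) * (1 - x) ^ (3 : ℕ) * (s * x) ^ (2 : ℕ) * (1 - s * x) ^ (4 : ℕ))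
    + (12 : R) * (t ^ (4 : ℕ) * (1 - t) ^ (2 : ℕ) * (s * t) ^ (1 : ℕ) * (1 - s * x * t) ^ (2 : ℕ) * x ^ (1 : ℕ) * (1 - x) ^ (2 : ℕ) * (1 - s * x) ^ (6 : ℕ))
    + (2 : R) * (t ^ (4 : ℕ) * (1 - t) ^ (2 : ℕ) * (s * t) ^ (1 : ℕ) * (1 - s * x * t) ^ (2 : ℕ) * x ^ (1 : ℕ) * (1 - x) ^ (2 : ℕ) * (s * x) ^ (1 : ℕ) * (1 - s * x) ^ (5 : ℕ))
    + (2 : R) * (t ^ (4 : ℕ) * (1 - t) ^ (2 : ℕ) * (s * t) ^ (1 : ℕ) * (1 - s * x * t) ^ (2 : ℕ) * x ^ (2 : ℕ) * (1 - x) ^ (1 : ℕ) * (1 - s * x) ^ (6 : ℕ))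
    + (12 : R) * (t ^ (4 : ℕ) * (1 - t) ^ (2 : ℕ) * (s * t) ^ (1 : ℕ) * (s * x * t) ^ (1 : ℕ) * (1 - s * x * t) ^ (1 : ℕ) * (1 - x) ^ (3 : ℕ) * (1 - s * x) ^ (6 : ℕ))
    + (2 : R) * (t ^ (4 : ℕ) * (1 - t) ^ (2 : ℕ) * (s * t) ^ (1 : ℕ) * (s * x * t) ^ (1 : ℕ) * (1 - s * x * t) ^ (1 : ℕ) * (1 - x) ^ (3 : ℕ) * (s * x) ^ (1 : ℕ) * (1 - s * x) ^ (5 : ℕ))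
    + (6 : R) * (t ^ (4 : ℕ) * (1 - t) ^ (2 : ℕ) * (s * t) ^ (1 : ℕ) * (s * x * t) ^ (1 : ℕ) * (1 - s * x * t) ^ (1 : ℕ) * x ^ (1 : ℕ) * (1 - x) ^ (2 : ℕ) * (1 - s * x) ^ (6 : ℕ))
    + (2 : R) * (t ^ (4 : ℕ) * (1 - t) ^ (2 : ℕ) * (s * t) ^ (1 : ℕ) * (s * x * t) ^ (2 : ℕ) * (1 - x) ^ (3 : ℕ) * (1 - s * x) ^ (6 : ℕ))
    + (8 : R) * (t ^ (5 : ℕ) * (1 - t) ^ (1 : ℕ) * (s * t) ^ (1 : ℕ) * (1 - s * x * t) ^ (2 : ℕ) * (1 - x) ^ (3 : ℕ) * (1 - s * x) ^ (6 : ℕ))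
    + (4 : R) * (t ^ (5 : ℕ) * (1 - t) ^ (1 : ℕ) * (s * t) ^ (1 : ℕ) * (1 - s * x * t) ^ (2 : ℕ) * x ^ (1 : ℕ) * (1 - x) ^ (2 : ℕ) * (1 - s * x) ^ (6 : ℕ))
    + (4 : R) * (t ^ (5 : ℕ) * (1 - t) ^ (1 : ℕ) * (s * t) ^ (1 : ℕ) * (s * x * t) ^ (1 : ℕ) * (1 - s * x * t) ^ (1 : ℕ) * (1 - x) ^ (3 : ℕ) * (1 - s * x) ^ (6 : ℕ))
    + (2 : R) * (t ^ (6 : ℕ) * (s * t) ^ (1 : ℕ) * (1 - s * x * t) ^ (2 : ℕ) * (1 - x) ^ (3 : ℕ) * (1 - s * x) ^ (6 : ℕ))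

/-- The `122` keys of the valid labelled patterns with their multiplicities (`Σ = 540`), i.e. the
grouped terms of `𝒯 = Σ_P Π_i wᵢ/(1-wᵢ)`; recomputed data, certified against the pattern data by
`keyTable_spec`. [cite: Rechnitzer2006Haruspicy2, Lemma 21] -/
def keyTable : List ((ℕ × ℕ × ℕ × ℕ × ℕ) × ℕ) := [
  ((0, 1, 0, 0, 2), 2),
  ((0, 1, 0, 0, 3), 8),
  ((0, 1, 0, 0, 4), 12),
  ((0, 1, 0, 0, 5), 8),
  ((0, 1, 0, 0, 6), 2),
  ((0, 1, 0, 1, 2), 4),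
  ((0, 1, 0, 1, 3), 12),
  ((0, 1, 0, 1, 4), 12),
  ((0, 1, 0, 1, 5), 4),
  ((0, 1, 0, 2, 2), 2),
  ((0, 1, 0, 2, 3), 4),
  ((0, 1, 0, 2, 4), 2),
  ((0, 1, 1, 0, 2), 4),
  ((0, 1, 1, 0, 3), 12),
  ((0, 1, 1, 0, 4), 12),
  ((0, 1, 1, 0, 5), 4),
  ((0, 1, 1, 1, 2), 6),
  ((0, 1, 1, 1, 3), 12),
  ((0, 1, 1, 1, 4), 6),
  ((0, 1, 1, 2, 2), 2),
  ((0, 1, 1, 2, 3), 2),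
  ((0, 1, 2, 0, 2), 2),
  ((0, 1, 2, 0, 3), 4),
  ((0, 1, 2, 0, 4), 2),
  ((0, 1, 2, 1, 2), 2),
  ((0, 1, 2, 1, 3), 2),
  ((1, 0, 0, 0, 3), 2),
  ((1, 0, 0, 0, 4), 2),
  ((1, 0, 0, 1, 3), 6),
  ((1, 0, 0, 1, 4), 4),
  ((1, 0, 0, 2, 3), 6),
  ((1, 0, 0, 2, 4), 2),
  ((1, 0, 0, 3, 3), 2),
  ((1, 1, 0, 0, 2), 4),
  ((1, 1, 0, 0, 3), 8),
  ((1, 1, 0, 0, 4), 4),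
  ((1, 1, 0, 1, 2), 6),
  ((1, 1, 0, 1, 3), 8),
  ((1, 1, 0, 1, 4), 2),
  ((1, 1, 0, 2, 2), 2),
  ((1, 1, 0, 2, 3), 2),
  ((1, 1, 1, 0, 2), 6),
  ((1, 1, 1, 0, 3), 8),
  ((1, 1, 1, 0, 4), 2),
  ((1, 1, 1, 1, 2), 8),
  ((1, 1, 1, 1, 3), 4),
  ((1, 1, 1, 2, 2), 2),
  ((1, 1, 2, 0, 2), 2),
  ((1, 1, 2, 0, 3), 2),
  ((1, 1, 2, 1, 2), 2),
  ((2, 0, 0, 0, 3), 2),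
  ((2, 0, 0, 0, 4), 2),
  ((2, 0, 0, 1, 3), 4),
  ((2, 0, 0, 1, 4), 2),
  ((2, 0, 0, 2, 3), 2),
  ((2, 1, 0, 0, 0), 2),
  ((2, 1, 0, 0, 1), 4),
  ((2, 1, 0, 0, 2), 4),
  ((2, 1, 0, 0, 3), 4),
  ((2, 1, 0, 0, 4), 2),
  ((2, 1, 0, 1, 0), 4),
  ((2, 1, 0, 1, 1), 6),
  ((2, 1, 0, 1, 2), 4),
  ((2, 1, 0, 1, 3), 2),
  ((2, 1, 0, 2, 0), 2),
  ((2, 1, 0, 2, 1), 2),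
  ((2, 1, 1, 0, 0), 4),
  ((2, 1, 1, 0, 1), 6),
  ((2, 1, 1, 0, 2), 4),
  ((2, 1, 1, 0, 3), 2),
  ((2, 1, 1, 1, 0), 6),
  ((2, 1, 1, 1, 1), 8),
  ((2, 1, 1, 1, 2), 4),
  ((2, 1, 1, 2, 0), 2),
  ((2, 1, 1, 2, 1), 2),
  ((2, 1, 2, 0, 0), 2),
  ((2, 1, 2, 0, 1), 2),
  ((2, 1, 2, 1, 0), 2),
  ((2, 1, 2, 1, 1), 2),
  ((3, 0, 0, 0, 1), 2),
  ((3, 0, 0, 0, 2), 2),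
  ((3, 0, 0, 1, 1), 6),
  ((3, 0, 0, 1, 2), 4),
  ((3, 0, 0, 2, 1), 6),
  ((3, 0, 0, 2, 2), 2),
  ((3, 0, 0, 3, 1), 2),
  ((3, 1, 0, 0, 0), 8),
  ((3, 1, 0, 0, 1), 8),
  ((3, 1, 0, 0, 2), 4),
  ((3, 1, 0, 1, 0), 12),
  ((3, 1, 0, 1, 1), 8),
  ((3, 1, 0, 1, 2), 2),
  ((3, 1, 0, 2, 0), 4),
  ((3, 1, 0, 2, 1), 2),
  ((3, 1, 1, 0, 0), 12),
  ((3, 1, 1, 0, 1), 8),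
  ((3, 1, 1, 0, 2), 2),
  ((3, 1, 1, 1, 0), 12),
  ((3, 1, 1, 1, 1), 4),
  ((3, 1, 1, 2, 0), 2),
  ((3, 1, 2, 0, 0), 4),
  ((3, 1, 2, 0, 1), 2),
  ((3, 1, 2, 1, 0), 2),
  ((4, 0, 0, 0, 1), 2),
  ((4, 0, 0, 0, 2), 2),
  ((4, 0, 0, 1, 1), 4),
  ((4, 0, 0, 1, 2), 2),
  ((4, 0, 0, 2, 1), 2),
  ((4, 1, 0, 0, 0), 12),
  ((4, 1, 0, 0, 1), 4),
  ((4, 1, 0, 0, 2), 2),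
  ((4, 1, 0, 1, 0), 12),
  ((4, 1, 0, 1, 1), 2),
  ((4, 1, 0, 2, 0), 2),
  ((4, 1, 1, 0, 0), 12),
  ((4, 1, 1, 0, 1), 2),
  ((4, 1, 1, 1, 0), 6),
  ((4, 1, 2, 0, 0), 2),
  ((5, 1, 0, 0, 0), 8),
  ((5, 1, 0, 1, 0), 4),
  ((5, 1, 1, 0, 0), 4),
  ((6, 1, 0, 0, 0), 2)]

/-- The key table is the concatenation of the five chunks. [folklore] -/
theorem keyTable_eq_append : keyTable = certChunk1 ++ certChunk2 ++ certChunk3 ++ certChunk4 ++ certChunk5 := by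
  decide +kernel

/-- The keys of the pattern data. [folklore] -/
def keyList : List (ℕ × ℕ × ℕ × ℕ × ℕ) := validPatsData.map bbKey

/-- Data check 1: every gap weight is one of the five types. [folklore] -/
theorem keyTable_spec1 : (validPatsData.all fun P => (weights P).all fun μ => fiveL.contains μ) = true := by
  decide +kernel

/-- Data check 2: the multiplicities of the tabulated keys. [folklore] -/
theorem keyTable_spec2 : (keyTable.all fun kc => keyList.count kc.1 == kc.2) = true := by
  decide +kernel

/-- Data check 3: every key of the data is tabulated. [folklore] -/
theorem keyTable_spec3 : (keyList.all fun k => (keyTable.map Prod.fst).contains k) = true := by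
  decide +kernel

/-- Data check 4: positive multiplicities, keys within the caps. [folklore] -/
theorem keyTable_spec4 : (keyTable.all fun kc => Nat.ble 1 kc.2 && Nat.ble kc.1.1 6 && Nat.ble kc.1.2.1 1 &&
    Nat.ble kc.1.2.2.1 2 && Nat.ble kc.1.2.2.2.1 3 && Nat.ble kc.1.2.2.2.2 6) = true := by
  decide +kernel

/-- Data check 5: the tabulated keys are pairwise distinct. [folklore] -/
theorem keyTable_spec5 : (keyTable.map Prod.fst).Nodup := by
  decide +kernel

/-- **Kernel check of the key table against the pattern data**: every gap weight is one of the
five types, the multiplicity of every bbKey of the table in the data is as tabulated, every bbKey of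
the data is in the table, the tabulated multiplicities are positive with keys within the caps
`(6, 1, 2, 3, 6)` and pairwise distinct. [cite: Rechnitzer2006Haruspicy2, Lemma 21] -/
theorem keyTable_spec :
    (validPatsData.all fun P => (weights P).all fun μ => fiveL.contains μ) = true ∧
    (keyTable.all fun kc => keyList.count kc.1 == kc.2) = true ∧
    (keyList.all fun k => (keyTable.map Prod.fst).contains k) = true ∧
    (keyTable.all fun kc => Nat.ble 1 kc.2 && Nat.ble kc.1.1 6 && Nat.ble kc.1.2.1 1 && Nat.ble kc.1.2.2.1 2 &&
      Nat.ble kc.1.2.2.2.1 3 && Nat.ble kc.1.2.2.2.2 6) = true ∧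
    (keyTable.map Prod.fst).Nodup :=
  ⟨keyTable_spec1, keyTable_spec2, keyTable_spec3, keyTable_spec4, keyTable_spec5⟩

/-- Every gap weight of a valid pattern is one of the five types. [cite: Rechnitzer2006Haruspicy2, Lemma 21] -/
theorem mem_fiveL_of_mem {P : LPat} (hP : P ∈ validPats) {μ : Wt} (hμ : μ ∈ weights P) : μ ∈ fiveL := by
  have h := keyTable_spec.1
  rw [List.all_eq_true] at h
  rw [validPats_eq] at hP
  have := List.all_eq_true.mp (h P hP) μ hμ
  simpa using this

/-- The bbKey of a valid pattern is within the caps. [cite: Rechnitzer2006Haruspicy2, Lemma 21] -/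
theorem key_le_of_mem {P : LPat} (hP : P ∈ validPats) :
    (bbKey P).1 ≤ 6 ∧ (bbKey P).2.1 ≤ 1 ∧ (bbKey P).2.2.1 ≤ 2 ∧ (bbKey P).2.2.2.1 ≤ 3 ∧ (bbKey P).2.2.2.2 ≤ 6 := by
  obtain ⟨-, -, h3, h4, -⟩ := keyTable_spec
  rw [List.all_eq_true] at h3 h4
  have hk : bbKey P ∈ keyList := by
    rw [keyList]; rw [validPats_eq] at hP; exact List.mem_map.mpr ⟨P, hP, rfl⟩
  have := h3 _ hk
  rw [List.contains_iff_mem, List.mem_map] at this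
  obtain ⟨kc, hkc, hkey⟩ := this
  have hc := h4 kc hkc
  simp only [Bool.and_eq_true, Nat.ble_eq] at hc
  rw [← hkey]
  exact ⟨hc.1.1.1.1.2, hc.1.1.1.2, hc.1.1.2, hc.1.2, hc.2⟩

end Keys

/-! ### `D₂ · S = term`: the pattern series cleared of denominators -/

section Clearing

/-- The monomial in terms of the three "variables" `t = X`, `s = sO`, `x = xO` of `ℚ[s]⟦x⟧⟦t⟧`.
[folklore] -/
theorem mono_eq (a b e : ℕ) : mono a b e = PowerSeries.X ^ a * sO ^ b * xO ^ e := by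
  rw [mono, sO, xO, ← map_pow, ← map_pow, mul_assoc, ← map_mul]
  congr 2
  rw [show ((sP : ℚ[X][X]) : PowerSeries ℚ[X]) = PowerSeries.C (Polynomial.X : ℚ[X]) from Polynomial.coe_C _, ← map_pow,
    mul_comm]

/-- The pattern series with prescribed multiplicities of the five weight types.
[cite: Rechnitzer2006Haruspicy2, Lemma 21] -/
theorem S_eq_of_subset {ws : List Wt} (h : ∀ μ ∈ ws, μ ∈ fiveL) :
    S ws = gp (1, 0, 0) ^ ws.count (1, 0, 0) * (gp (1, 1, 0) ^ ws.count (1, 1, 0) * (gp (1, 1, 1) ^ ws.count (1, 1, 1) *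
      (gp (0, 0, 1) ^ ws.count (0, 0, 1) * gp (0, 1, 1) ^ ws.count (0, 1, 1)))) := by
  induction ws with
  | nil => simp [S]
  | cons μ ws ih =>
    have hμ := h μ (by simp)
    rw [S, List.map_cons, List.prod_cons, ← S, ih (fun ν hν => h ν (by simp [hν]))]
    simp only [fiveL, List.mem_cons, List.not_mem_nil, or_false] at hμ
    rcases hμ with rfl | rfl | rfl | rfl | rfl <;> simp <;> ring

/-- The common denominator `D₂ = (1-t)⁶(1-st)(1-stx)²(1-x)³(1-sx)⁶`, over the five weight types.
[cite: Rechnitzer2006Haruspicy2, eqs. (29), (31)] -/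
def bbD : R3 :=
  (1 - mono 1 0 0) ^ 6 * (1 - mono 1 1 0) ^ 1 * (1 - mono 1 1 1) ^ 2 * (1 - mono 0 0 1) ^ 3 * (1 - mono 0 1 1) ^ 6

/-- The cleared term of a key `(p,q,r,u,v)`:
`tᵖ(1-t)^{6-p} (st)^q(1-st)^{1-q} (stx)ʳ(1-stx)^{2-r} xᵘ(1-x)^{3-u} (sx)ᵛ(1-sx)^{6-v}`, generic in
three commuting variables. [cite: Rechnitzer2006Haruspicy2, Lemma 21] -/
def termG {R : Type*} [CommRing R] (s x t : R) (k : ℕ × ℕ × ℕ × ℕ × ℕ) : R :=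
  t ^ k.1 * (1 - t) ^ (6 - k.1) * (s * t) ^ k.2.1 * (1 - s * t) ^ (1 - k.2.1) * (s * x * t) ^ k.2.2.1 *
    (1 - s * x * t) ^ (2 - k.2.2.1) * x ^ k.2.2.2.1 * (1 - x) ^ (3 - k.2.2.2.1) * (s * x) ^ k.2.2.2.2 *
    (1 - s * x) ^ (6 - k.2.2.2.2)

/-- One weight type cleared: `(1-m)^cap · gp^c = (1-m)^{cap-c} · m^c` for `c ≤ cap`. [folklore] -/
theorem clear_one {μ : Wt} (hμ : 1 ≤ μ.1 + μ.2.2) {cap c : ℕ} (hc : c ≤ cap) :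
    (1 - mono μ.1 μ.2.1 μ.2.2) ^ cap * gp μ ^ c = (1 - mono μ.1 μ.2.1 μ.2.2) ^ (cap - c) * mono μ.1 μ.2.1 μ.2.2 ^ c := by
  have h := one_sub_mono_mul_gp hμ
  calc (1 - mono μ.1 μ.2.1 μ.2.2) ^ cap * gp μ ^ c
      = (1 - mono μ.1 μ.2.1 μ.2.2) ^ (cap - c) * ((1 - mono μ.1 μ.2.1 μ.2.2) * gp μ) ^ c := by
        rw [mul_pow, ← mul_assoc, ← pow_add, Nat.sub_add_cancel hc]
    _ = _ := by rw [h]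

/-- **The pattern series cleared of denominators**: `D₂ · S(weights P) = term (key P)` for a
valid pattern. [cite: Rechnitzer2006Haruspicy2, Lemma 21] -/
theorem bbD_mul_S {P : LPat} (hP : P ∈ validPats) : bbD * S (weights P) = termG sO xO PowerSeries.X (bbKey P) := by
  obtain ⟨c1, c2, c3', c4, c5⟩ := key_le_of_mem hP
  simp only [bbKey] at c1 c2 c3' c4 c5
  rw [S_eq_of_subset (fun μ hμ => mem_fiveL_of_mem hP hμ), bbD]
  have e1 := clear_one (μ := (1, 0, 0)) (by norm_num) c1
  have e2 := clear_one (μ := (1, 1, 0)) (by norm_num) c2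
  have e3 := clear_one (μ := (1, 1, 1)) (by norm_num) c3'
  have e4 := clear_one (μ := (0, 0, 1)) (by norm_num) c4
  have e5 := clear_one (μ := (0, 1, 1)) (by norm_num) c5
  simp only at e1 e2 e3 e4 e5
  calc _ = ((1 - mono 1 0 0) ^ 6 * gp (1, 0, 0) ^ (weights P).count (1, 0, 0)) *
        ((1 - mono 1 1 0) ^ 1 * gp (1, 1, 0) ^ (weights P).count (1, 1, 0)) *
        ((1 - mono 1 1 1) ^ 2 * gp (1, 1, 1) ^ (weights P).count (1, 1, 1)) *
        ((1 - mono 0 0 1) ^ 3 * gp (0, 0, 1) ^ (weights P).count (0, 0, 1)) *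
        ((1 - mono 0 1 1) ^ 6 * gp (0, 1, 1) ^ (weights P).count (0, 1, 1)) := by ring
    _ = _ := by
      rw [e1, e2, e3, e4, e5, termG, bbKey]
      simp only [mono_eq, pow_zero, pow_one, one_mul, mul_one]
      ring

end Clearing

/-! ### Regrouping by keys, the certificate, and the final identity -/

section Final

/-- **Regrouping the cleared terms by keys**: `Σ_{P ∈ validPats} f (key P) = Σ_{(k,c) ∈ keyTable} c · f k`.
[cite: Rechnitzer2006Haruspicy2, Lemma 21] -/
theorem sum_key_eq_sum_keyTable (f : ℕ × ℕ × ℕ × ℕ × ℕ → R3) :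
    ∑ P ∈ validPats.toFinset, f (bbKey P) = (keyTable.map fun kc => (kc.2 : R3) * f kc.1).sum := by
  classical
  obtain ⟨-, h2, h3, h4, h5⟩ := keyTable_spec
  rw [List.all_eq_true] at h2 h3 h4
  have hl : validPats.map bbKey = keyList := by rw [keyList, validPats_eq]
  rw [List.sum_toFinset _ nodup_validPats, show (fun P => f (bbKey P)) = f ∘ bbKey from rfl, ← List.map_map, hl,
    Finset.sum_list_map_count]
  have hset : keyList.toFinset = (keyTable.map Prod.fst).toFinset := by
    ext k
    rw [List.mem_toFinset, List.mem_toFinset]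
    constructor
    · intro hk; have := h3 k hk; rwa [List.contains_iff_mem] at this
    · intro hk
      rw [List.mem_map] at hk
      obtain ⟨kc, hkc, rfl⟩ := hk
      have hcount : keyList.count kc.1 = kc.2 := by have := h2 kc hkc; simpa using this
      have hpos : 1 ≤ kc.2 := by have := h4 kc hkc; simp only [Bool.and_eq_true, Nat.ble_eq] at this; exact this.1.1.1.1.1
      exact List.count_pos_iff.mp (by omega)
  rw [hset, List.sum_toFinset _ h5, List.map_map]
  congr 1
  apply List.map_congr_left
  intro kc hkc
  have hcount : keyList.count kc.1 = kc.2 := by have := h2 kc hkc; simpa using this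
  rw [Function.comp_apply, nsmul_eq_mul]
  simp only [List.count, beq_eq_decide] at hcount ⊢
  rw [hcount]

/-- The chunk sums, spelled out. [cite: Rechnitzer2006Haruspicy2, Lemma 21] -/
theorem certChunk1_sum (s x t : R3) :
    (certChunk1.map fun kc => (kc.2 : R3) * termG s x t kc.1).sum = certPart1 s x t := by
  simp only [certChunk1, List.map_cons, List.map_nil, List.sum_cons, List.sum_nil, termG, Nat.cast_ofNat, Nat.reduceSub,
    pow_zero, pow_one, one_mul, mul_one, add_zero, certPart1]
  ring

/-- The chunk sums, spelled out. [cite: Rechnitzer2006Haruspicy2, Lemma 21] -/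
theorem certChunk2_sum (s x t : R3) :
    (certChunk2.map fun kc => (kc.2 : R3) * termG s x t kc.1).sum = certPart2 s x t := by
  simp only [certChunk2, List.map_cons, List.map_nil, List.sum_cons, List.sum_nil, termG, Nat.cast_ofNat, Nat.reduceSub,
    pow_zero, pow_one, one_mul, mul_one, add_zero, certPart2]
  ring

/-- The chunk sums, spelled out. [cite: Rechnitzer2006Haruspicy2, Lemma 21] -/
theorem certChunk3_sum (s x t : R3) :
    (certChunk3.map fun kc => (kc.2 : R3) * termG s x t kc.1).sum = certPart3 s x t := by
  simp only [certChunk3, List.map_cons, List.map_nil, List.sum_cons, List.sum_nil, termG, Nat.cast_ofNat, Nat.reduceSub,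
    pow_zero, pow_one, mul_one, add_zero, certPart3]
  ring

/-- The chunk sums, spelled out. [cite: Rechnitzer2006Haruspicy2, Lemma 21] -/
theorem certChunk4_sum (s x t : R3) :
    (certChunk4.map fun kc => (kc.2 : R3) * termG s x t kc.1).sum = certPart4 s x t := by
  simp only [certChunk4, List.map_cons, List.map_nil, List.sum_cons, List.sum_nil, termG, Nat.cast_ofNat, Nat.reduceSub,
    pow_zero, pow_one, mul_one, add_zero, certPart4]
  ring

/-- The chunk sums, spelled out. [cite: Rechnitzer2006Haruspicy2, Lemma 21] -/
theorem certChunk5_sum (s x t : R3) :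
    (certChunk5.map fun kc => (kc.2 : R3) * termG s x t kc.1).sum = certPart5 s x t := by
  simp only [certChunk5, List.map_cons, List.map_nil, List.sum_cons, List.sum_nil, termG, Nat.cast_ofNat, Nat.reduceSub,
    pow_zero, pow_one, mul_one, add_zero, certPart5]
  ring

set_option maxHeartbeats 8000000 in
/-- **The certificate**: the sum of the cleared terms of the `540` valid labelled patterns, grouped
by their `122` keys, is `(1 - stx) · Ñ` with `Ñ = lem21Num` the numerator of Lemma 21 over the
common denominator of eq. (29) — a polynomial identity in three variables (`15397` monomials before
collection), checked by `ring`. [cite: Rechnitzer2006Haruspicy2, Lemma 21] -/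
theorem certParts_sum (s x t : R3) :
    certPart1 s x t + certPart2 s x t + certPart3 s x t + certPart4 s x t + certPart5 s x t = (1 - s * x * t) * lem21Num s x t := by
  unfold certPart1 certPart2 certPart3 certPart4 certPart5
    lem21Num lem21N1 lem21N2 lem21N3 lem21N4 lem21N5 lem21N6 lem21N7 lem21N8
  ring

/-- **The certificate**, over the key table. [cite: Rechnitzer2006Haruspicy2, Lemma 21] -/
theorem bb_certificate (s x t : R3) :
    (keyTable.map fun kc => (kc.2 : R3) * termG s x t kc.1).sum = (1 - s * x * t) * lem21Num s x t := by
  rw [keyTable_eq_append, List.map_append, List.map_append, List.map_append, List.map_append, List.sum_append, List.sum_append,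
    List.sum_append, List.sum_append, certChunk1_sum, certChunk2_sum, certChunk3_sum, certChunk4_sum, certChunk5_sum,
    certParts_sum]

/-- `1 - stx` as `1 - C(sx)·X`, and `s`, `x`, `st x` in `ℚ[s]⟦x⟧⟦t⟧`. [folklore] -/
theorem one_sub_sxt_eq : (1 - sO * xO * PowerSeries.X : R3) =
    1 - PowerSeries.C (((sP * Polynomial.X : ℚ[X][X]) : PowerSeries ℚ[X])) * PowerSeries.X := by
  rw [sO, xO, Polynomial.coe_mul, Polynomial.coe_X, map_mul]

/-- The two spellings of the common denominator agree:
`(1 - stx) · [(1-x)³(1-sx)⁶(1-t)⁶(1-st)(1-stx)] = D₂`. [cite: Rechnitzer2006Haruspicy2, eqs. (29), (31)] -/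
theorem bbD_eq : (1 - sO * xO * PowerSeries.X) * ((1 - xO) ^ 3 * (1 - sO * xO) ^ 6 *
    ((1 - PowerSeries.X) ^ 6 * (1 - sO * PowerSeries.X) * (1 - sO * xO * PowerSeries.X))) = bbD := by
  rw [bbD]
  simp only [mono_eq, pow_zero, pow_one, one_mul, mul_one]
  ring

/-- `D₂ · Σ_{P ∈ s} S = Σ_{P ∈ s} term (key P)` for any set of valid patterns (kept generic in the set:
the kernel must not be tempted to evaluate `validPats`). [cite: Rechnitzer2006Haruspicy2, Lemma 21] -/
theorem bbD_mul_sum_S (s : Finset LPat) (hs : ∀ P ∈ s, P ∈ validPats) :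
    bbD * ∑ P ∈ s, S (weights P) = ∑ P ∈ s, termG sO xO PowerSeries.X (bbKey P) := by
  rw [Finset.mul_sum]
  exact Finset.sum_congr rfl fun P hP => bbD_mul_S (hs P hP)

/-- **`D₂ · 𝒯` is the sum of the cleared terms over the valid patterns.** [cite: Rechnitzer2006Haruspicy2, Lemma 21] -/
theorem bbD_mul_bbSeries_eq_sum :
    bbD * bbSeries = ∑ P ∈ validPats.toFinset, termG sO xO PowerSeries.X (bbKey P) := by
  rw [bbSeries_eq_sum]
  exact bbD_mul_sum_S validPats.toFinset fun P hP => List.mem_toFinset.mp hP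

/-- **`D₂ · 𝒯` over the key table.** [cite: Rechnitzer2006Haruspicy2, Lemma 21] -/
theorem bbD_mul_bbSeries :
    bbD * bbSeries = (keyTable.map fun kc => (kc.2 : R3) * termG sO xO PowerSeries.X kc.1).sum := by
  rw [bbD_mul_bbSeries_eq_sum]
  exact sum_key_eq_sum_keyTable (termG sO xO PowerSeries.X)

/-- The certificate in `ℚ[s]⟦x⟧⟦t⟧`. [cite: Rechnitzer2006Haruspicy2, Lemma 21] -/
theorem bb_certificate_R3 :
    (keyTable.map fun kc => (kc.2 : R3) * termG sO xO PowerSeries.X kc.1).sum =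
      (1 - sO * xO * PowerSeries.X) * lem21Num sO xO PowerSeries.X :=
  bb_certificate sO xO PowerSeries.X

/-- **Lemma 21 in cleared form**: `(1-x)³(1-sx)⁶(1-t)⁶(1-st)(1-stx) · 𝒯 = Ñ` in `ℚ[s]⟦x⟧⟦t⟧`, where
`𝒯 = bbSeries` is the generating function of the 2-4-2 building blocks (on the rooted-walk counts
`bbCount`) and `Ñ = lem21Num` is the numerator obtained from the PRINTED `T̂` of Lemma 21.
[cite: Rechnitzer2006Haruspicy2, Lemma 21] -/
theorem lem21_cleared : (1 - xO) ^ 3 * (1 - sO * xO) ^ 6 *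
    ((1 - PowerSeries.X) ^ 6 * (1 - sO * PowerSeries.X) * (1 - sO * xO * PowerSeries.X)) * bbSeries = lem21Num sO xO PowerSeries.X := by
  apply cancel_one_sub_C_mul_X (((sP * Polynomial.X : ℚ[X][X]) : PowerSeries ℚ[X]))
  rw [← one_sub_sxt_eq, ← mul_assoc, bbD_eq, bbD_mul_bbSeries, bb_certificate_R3]

/-- **Rechnitzer 2006, eq. (29) with (31), DISCHARGED**: the partial fraction form of the
building-block generating function, from Lemma 21 (`lem21_cleared`: this file and
`SAPBuildingBlocksMoves`, `SAPBuildingBlocksPatterns`) and the certified partial fractions of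
`SAPAnisotropicNotDFinite242PartialFractions` (`Rechnitzer2006_eq29_of_lem21Num`).
[cite: Rechnitzer2006Haruspicy2, Lemma 21, Lemma 24, eqs. (29), (31)] -/
theorem _root_.Literature.Barriers.CriticalPhenomena.Rechnitzer2006_eq29_holds : Rechnitzer2006_eq29 :=
  Rechnitzer2006_eq29_of_lem21Num lem21_cleared

/-- Hence Rechnitzer's Lemma 25 (the recurrence for `f_n(s;x)`) holds unconditionally
(`Rechnitzer2006_lem23_holds`, `Rechnitzer2006_eq29_holds`). [cite: Rechnitzer2006Haruspicy2, Lemma 25] -/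
theorem _root_.Literature.Barriers.CriticalPhenomena.Rechnitzer2006_lem25_rec_holds : Rechnitzer2006_lem25_rec :=
  Rechnitzer2006_lem25_rec_of_lem23_eq29 Rechnitzer2006_lem23_holds Rechnitzer2006_eq29_holds

end Final

end Haruspicy

end Literature.Barriers.CriticalPhenomena
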